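import Mathlib
import HarnessLib
import HarnessLib.Audit
import Summits.BirchSwinnertonDyer.Statement
import Literature.NumberTheory.EllipticCurves.IwasawaAlgebraInvolution
import Literature.Uncategorized.OrdPublishedInputsAtTwo
import Summits.BirchSwinnertonDyer.BirchSwinnertonDyer.Theorems.ByReductionTypeAtTwoOrdHalvesDefs
import Summits.BirchSwinnertonDyer.BirchSwinnertonDyer.Theorems.TwoAdicConverseLambdaHalfDefs
import Literature.NumberTheory.EllipticCurves.BSDQuadraticDescent
import Literature.NumberTheory.EllipticCurves.Isogeny
import Summits.BirchSwinnertonDyer.BirchSwinnertonDyer.Theorems.ByReductionTypeAtTwoOrdMissingLowerBoundDefs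
import Literature.NumberTheory.EllipticCurves.Rank1Residual.Typed.Basic
import Literature.NumberTheory.EllipticCurves.LeadingTerm
import Literature.NumberTheory.EllipticCurves.ManinConstantSemistablePrimewise
import Literature.NumberTheory.EllipticCurves.Kato2004.EulerSystemBoundFineSelmerTwo
import Summits.BirchSwinnertonDyer.BirchSwinnertonDyer.Theorems.ByReductionTypeAtTwoOrdKatoOptimalDefs
import Summits.BirchSwinnertonDyer.BirchSwinnertonDyer.Theorems.ByReductionTypeAtTwoOrdKatoIntDefs
import Literature.NumberTheory.EllipticCurves.ManinConstantGamma1Gamma0Comparison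
import Literature.NumberTheory.EllipticCurves.Greenberg1999.TwoTorsionMuInvariant
import Literature.NumberTheory.EllipticCurves.Kato2004.MemberHullInputsTwoNoSplitTwistSharp
import Summits.BirchSwinnertonDyer.BirchSwinnertonDyer.Theorems.ByReductionTypeAtTwoRankOneAtTwoOneDoorLawFirstLayerDefs
import Summits.BirchSwinnertonDyer.BirchSwinnertonDyer.Theorems.GenusKolyvaginAtTwoCasselsTatePairingRat
import Summits.BirchSwinnertonDyer.BirchSwinnertonDyer.Theorems.ManinLocalTwoThreeAbbesUllmoCesnaviciusManinConstant
import Summits.BirchSwinnertonDyer.BirchSwinnertonDyer.Theorems.ByReductionTypeAtTwoProp514Kernel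
import Summits.BirchSwinnertonDyer.BirchSwinnertonDyer.Theorems.Rank1ResidualX5TwoDefs
import HarnessLib.Audit.Status.Attr

/-!
Route: ByReductionTypeAtTwo

# Route ByReductionTypeAtTwo — BSD at 2 for non-CM curves of analytic rank at most 1, by reduction
type at 2

It suffices to show the 2-part of the Birch–Swinnerton-Dyer formula (Miller's `BSDp W 2`: rank part,
`Ш[2^∞]` finite,
`ord₂ #Ш_an = ord₂ #Ш[2^∞]`) for every non-CM elliptic curve `E/ℚ` of analytic rank ≤ 1 BRANCH BY
BRANCH in the reduction
type of `E` at 2: X = X₀ᵒʳᵈ ∧ X₀ᵐᵘˡᵗ ∧ X₀ˢˢ ∧ X₀ᵃᵈᵈ ∧ X₁ with X₀ᵒʳᵈ = `GoodOrdinaryRankZeroAtTwo`,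
X₀ᵐᵘˡᵗ =
`MultiplicativeRankZeroAtTwo`, X₀ˢˢ = `SupersingularRankZeroAtTwo`, X₀ᵃᵈᵈ = `AdditiveRankZeroAtTwo`
(analytic rank 0, the four
reduction types at 2) and X₁ = `RankOneAtTwo` (analytic rank 1, declared residual). The route is the
R5 alternative closer of the
rung leaf K4 `Summit.BirchSwinnertonDyer.BirchSwinnertonDyer.Rank1Residual.NonCMAtTwo` (D-0061:
«closes rung K4 of BirchSwinnertonDyer», never
summit credit) = the EXCLUDED-DOMAIN cell X5@2 of `bsdp_allCurves_of_not_corner_of_not_cornerF`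
(non-CM, p = 2). No card: the
line is the bsd-2adic cell's ladder rung (README §2 K4 ⇒ B1), routed per D-0059.
Lean: `∀ (W : WeierstrassCurve ℚ) [W.IsElliptic] [W.IsGloballyMinimal], ¬ W.HasCM → W.analyticRank ≤
1 → Literature.NumberTheory.EllipticCurves.BSDp W 2`

## Assembly
Pure logic over the definitions: `W.analyticRank ≤ 1` is `0 ∨ 1`
(`Nat.le_one_iff_eq_zero_or_eq_one`); at rank 0 the reduction of the
globally minimal W at 2 is good (then `2 ∤ a₂` = `GoodOrd` or `2 ∣ a₂` = `GoodSS`), multiplicative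
(`Mult`), or neither (`Addv := ¬Good ∧ ¬Mult`);
rank 1 is `RankOneAtTwo`. The deciding theorem `closes hOrd hMult hSS hAdd hR1 hA := hA hOrd hMult
hSS hAdd hR1` consumes every item
(PadicCornerSqueeze pattern, same sub); the sorry-free proof of the Assembly item (`assembly_holds`,
Sketch.lean / bc/Assembly_proof.lean,
lean check rc 0) is attached at birth and landed by the first prover.

CLOSES_TARGET: closes rung K4 of BirchSwinnertonDyer: Summit.BirchSwinnertonDyer.BirchSwinnertonDyer.Rank1Residual.NonCMAtTwo (D-0061; not the summit Statement) — the deciding theorem of this route concludes that registered leaf instead of the Statement decl `BirchSwinnertonDyer` (class rung: servable and labelled, never counted as concluding the summit Statement).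

Rationale: WHY THIS LINE. At an odd good ordinary prime the p-part of BSD in analytic rank ≤ 1 is a theorem
(Kato2004Asterisque Thm 17.4 + SkinnerUrban2014
+ GreenbergVatsal2000 / CastellaGrossiSkinner2025 at Eisenstein p; rank 1: JetchevSkinnerWan2017);
every one of these prints
«p odd» ([corpus:paper:url-79d6da346f06 p.158] Kato 17.4(3) «assume further p ≠ 2»;
[corpus:paper:doi-10-1007-s00222-013-0448-1
p.13] «p is a fixed odd prime»; [corpus:paper:arxiv-2409.01350 p.12] «p ≥ 3 … some results will also
hold even for p = 2»), so
p = 2 for non-CM E is exactly the residue the tree's partition theorem excludes. The mechanism is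
cyclotomic Iwasawa theory AT 2
read per reduction type, because the four types have four different 2-adic L-functions / Selmer
conditions and four different
printed footholds: good ordinary — Kato's λ-part divisibility at 2 (17.4(2) holds at p = 2) +
Greenberg's μ = 0 criterion at 2
(Greenberg1999LNM Prop 5.14, [corpus:book:coates1999-arithmetic-theory-elliptic-curves p.171]) +
Matsuno2008's 2-adic λ-transfer;
multiplicative — Skinner2016PacificMC's shape + Greenberg–Stevens at the exceptional zero;
supersingular — Kobayashi2003 /
Sprung2012 signed theory, untyped at 2; additive — Delbourgo1998 / Matsuno2008 Thm 5.1 twist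
transfer to a semistable twist.
Imported area: Iwasawa theory of ℤ₂-extensions and 2-descent (certified instance computation for the
calibration rungs). What the
line does that prior routes do not: every other route of this sub (PAdicOrder, PAdicOrderV2,
KatoTransfer, PadicCornerSqueeze, …)
attacks the RANK conjecture in rank ≥ 2 at odd p; this one is the FORMULA at the one prime they all
exclude, in the rank regime
where Ш is known finite, and its cruxes are the ∀-closures of the cell's typed X5 kernel objects
(honesty lemma
`nonCMAtTwo_iff_forall_missingInputAt`: modulo GZK the leaf is literally `∀ non-CM W,
Typed.X5.MissingInputAt W 2`).

RANKED CRUXES. #2 GoodOrdinaryRankZeroAtTwo (crux) — for every non-CM elliptic curve E/ℚ (globally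
minimal W) of analytic rank 0 with good ORDINARY reduction at 2, BSD₂(E) holds. Layer-2 objects
already typed in the X5 kernel: μ-part of Kato's divisibility at 2 `O1.KatoMuPartAtTwo` (⟺
`O1.MainConjectureLowerDivisibilityAtTwoOrd`, p400656), tower gap `O1.TowerGapAtTwo` (p400624),
Eisenstein lower bound `O1.MainConjectureEisensteinDivisibilityAtTwo`; landed doors (34-CF) p400882,
(34-GV) p402312, T-62 p400761, T-42 p402124. [difficulty: XL] (why it might fail: Kato 17.4(3)
excludes p = 2: the μ-part of the divisibility at 2 is open off Greenberg's Prop 5.14 locus, μ ≥ 1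
occurs on the 5.13 locus, and the Eisenstein lower bound at 2 has no printed source off the pinch
habitats (83/611 census classes).) [Kato2004Asterisque, Greenberg1999LNM, GreenbergVatsal2000,
Matsuno2008, SkinnerUrban2014, CastellaGrossiSkinner2025, Li2025TwoAdicMu]
#3 MultiplicativeRankZeroAtTwo (crux) — for every non-CM E/ℚ (globally minimal W) of analytic rank 0
with MULTIPLICATIVE reduction at 2 (split or non-split), BSD₂(E) holds. Layer-2 objects typed:
`O1.KatoMultiplicativeDivisibilityRat W 2` (p400711), `O1.MultLowerDivisibilityAtTwoRat` (p402103),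
Greenberg–Stevens at 2 (p401547/p402114), twist doors (34-TW-mult) p403141/p403509/p403815.
[difficulty: XL] (why it might fail: the lower (Eisenstein-side) divisibility for the
Mazur–Tate–Teitelbaum L̃ at a multiplicative 2 has no printed source, Kato's integral clause at 2 ∣
N is reached only ⊗ℚ, and at split 2 the exceptional zero forces a derivative formula known in print
for p ≥ 5 only.) [Skinner2016PacificMC, GreenbergStevens1993, Kato2004Asterisque, Matsuno2008,
Greenberg1999LNM, Delbourgo2008]
#4 SupersingularRankZeroAtTwo (crux) — for every non-CM E/ℚ (globally minimal W) of analytic rank 0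
with good SUPERSINGULAR reduction at 2 (a₂ ∈ {0, ±2}), BSD₂(E) holds. Layer-2 objects typed:
`SS.KobayashiLowerDivisibility W 2 ε`, the Sprung pair `exists_isSprungPair_two`, consumer
`SS.bsdp_two_of_oneDivisibility_of_blindControl` (Supersingular/BlindControlTwo.lean). [difficulty:
XL] (why it might fail: Sprung2012 has ♯/♭ Coleman maps and signed Selmer groups at p = 2 (JNT 132
p.1486), but main conjectures, control and Kato-side divisibility are printed for odd p only (ibid.
§7; Kobayashi2003; CCSS2018 «p ∤ N odd»): at 2 (a₂ ∈ {0, ±2}) no divisibility is typed; Kim's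
criterion is vacuous mod 2.) [Kobayashi2003, Sprung2012, Sprung2024, BDKim2013,
CastellaCiperianiSkinnerSprung2018, Kurihara2002]
#5 AdditiveRankZeroAtTwo (crux) — for every non-CM E/ℚ (globally minimal W) of analytic rank 0 with
ADDITIVE reduction at 2, BSD₂(E) holds. Layer-2 objects typed: the L2 doors (p400731), the K*-road
(p401880/p401883), the twist pinch `AddTwoL2Pinch.bsdp_two_of_twistPinch` (p404266) with Matsuno2008
Thm 5.1 at the ramified twist (p404073): BSD₂ of the additive curve from the Iwasawa theory of its
semistable quadratic twist over ℚ_∞. [difficulty: XL] (why it might fail: no Selmer condition or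
2-adic L-function at an additive 2 exists in print; 781 of the 1 945 census classes acquire
semistable reduction only over wildly ramified extensions of ℚ₂ where no descent/transfer is typed
(Delbourgo1998 needs p ≥ 5).) [Delbourgo1998, Matsuno2008, GreenbergVatsal2000, Kato2004Asterisque]
#6 RankOneAtTwo (crux) — for every non-CM E/ℚ (globally minimal W) of analytic rank exactly 1 (any
reduction at 2), BSD₂(E) holds — the 2-part of the Gross–Zagier–Kolyvagin index identity. Declared
tribunal RESIDUAL of the route (rank axis r = 1; typed object `O1.RankOneIndexIdentityAtTwo`, exact
per-pair door `P2.bsdp_two_iff_of_heegner_rankOne`). [difficulty: XL] (why it might fail: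
Kolyvagin's index bound carries an unspecified power of 2 (GrigorovJorzaPatrikisSteinTarnita2009 «p
odd»), the p-adic Waldspurger/BDP leading-term formula behind JetchevSkinnerWan2017 is printed for
odd good p only, and nothing exists at additive 2.) [JetchevSkinnerWan2017, GrossZagier1986,
Kolyvagin1990, GrigorovJorzaPatrikisSteinTarnita2009, Zhang2014]

TWO-LAYER PLAN. Foreseen glued splits (filed by `route edit --split` only as a branch earns it;
children = the cell's typed X5 kernel objects, ∀-closed):
`GoodOrdinaryRankZeroAtTwo ⇐ OrdMuPartAtTwo → OrdEisensteinLowerAtTwo → GoodOrdinaryRankZeroAtTwo`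
(glue = `X5.bsdp_of_missingInputAt` +
`O1.mainConjectureLowerDivisibilityAtTwoOrd_iff_katoMuPartAtTwo`); `MultiplicativeRankZeroAtTwo ⇐
MultKatoIntegralAtTwo → MultLowerAtTwo →
MultiplicativeRankZeroAtTwo` (glue = p400711 doors); `AdditiveRankZeroAtTwo ⇐ AddTwistTransferAtTwo
→ AddWildClassesAtTwo → AdditiveRankZeroAtTwo`
(glue = p404266 pinch door on the tame-twist classes). Supersingular and rank 1 stay undecomposed
until a signed theory at 2 / a 2-primary
Kolyvagin index statement is typed.

KILL CRITERIA. A refutation of any rank-0 crux (a non-CM curve of analytic rank 0 with `¬ BSDp W 2`,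
i.e. ord₂ #Ш_an ≠ ord₂ #Ш[2^∞] — computable
instance-wise by 2-power descents since Ш is finite here) refutes BSD itself and closes the route
`refuted:<Decl>` (and much more). A proof
that μ ≥ 1 is generic off the Prop 5.14 locus does NOT kill the line (μ enters only through the
comparison, not as a hypothesis) but forces
the good-ordinary split to carry an explicit μ-term. The line is mooted if the operator retires rung
K4 or if a route closes the summit.

NOT DECOMPOSED YET. The typed OBJECTS per branch (μ-part at 2, tower gap, Eisenstein lower bound,
multiplicative lower divisibility, signed supersingular
package at 2, additive twist transfer, rank-1 index identity) are deliberately NOT items at open: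
they are layer-2 children, filed per
branch by `route edit --split` when a prover line needs them (BC1: 6 load-bearing binders now; 8+
would be two theses). Door-ready
census classes (ord 11 CF + calibration, mult 19/1 976, additive 2 + 6) are instance rungs, landed
as Theorems `--supports <crux>`, never items.

CHEAPEST FALSIFIER. Instance lookup, one smallest-conductor non-CM rank-0 curve per reduction class
at 2: 17a1 (a₂ = −1, GoodOrd), 11a1 (a₂ = −2, GoodSS),
14a1 / 15a1 (Mult), 20a1 (Addv): compare ord₂ of the analytic Ш order with ord₂ #Ш[2^∞] from 2-power
descents — all agree (BSD is verified
for every curve of conductor < 5000 and rank ≤ 1, Creutz–Miller, [corpus:paper:arxiv-1107.3516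
p.21]); the cheap kill fails and the line
stands on its uniform statements. Ran: yes (lookup), and the cell's kit-certified rows for the 46 +
19 + 8 door-ready classes agree as well.

NUMBERS. Census (book230, N < 5·10⁵, non-CM, r_an ≤ 1, residue X5 at p = 2): 5 295 classes =
good-ordinary 611 + supersingular 763 + multiplicative
1 976 + additive 1 945; 5 275 of analytic rank 0, 20 of rank 1. Door-ready of record: mult 3/1 976
(RC-7 PASS) + 16 rank-aware (evidence tier);
ord 11 CF classes + 1 calibration class kernel-instantiated (candidates); additive 2/1 945 + 6
modulo a semistable-twist λ-statement.
Kato 17.4(2) (λ-part, height-one primes not containing p) holds at p = 2; 17.4(3) (full integrality)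
assumes p ≠ 2.

DEFINITION REQUESTS. None at open: every notion is typed (`BSDp`, `GoodOrd/GoodSS/Mult/Addv`,
`HasCM`, `analyticRank`, the X5 kernel objects). Cite facts
already landed or pending in the cell: Matsuno2008 Thm 5.1/3.1 (p404073 ACCEPTED), Greenberg
5.13/5.14/4.1 at 2, `kato_divisibility_allPrimes W 2`.

Novelty: Searches (2026-08-25): lit search --hybrid "Iwasawa main conjecture elliptic curve p = 2 Kato
divisibility" (10 docs; relevant: arxiv-2405.00270
p.2, delbourgo2008 book, coates1999 = Greenberg LNM 1716); lit vsearch "2-part of BSD formula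
analytic rank zero or one; main conjecture at 2;
Kato needs p odd" (10 docs, textbooks only); lit search local "Kato 17.4 divisibility p-adic zeta
Selmer" (6 docs: Astérisque 295 held as
paper:url-79d6da346f06; doi-10-4171-dm-450; arxiv-2404.05186); "Skinner Urban main conjectures GL2
hypotheses p odd" (2 docs); "Kobayashi
supersingular plus/minus Selmer odd" (8 docs, all odd p); "Sprung supersingular sharp flat main
conjecture" (4 docs); "Jetchev Skinner Wan
analytic rank one formula hypotheses" (5 docs: arxiv-2409.01350 p.9 «p>2 good ordinary»); lit galaxy
search --star all "2-adic main
conjecture|main conjecture for p = 2|2-part of the Birch" (0 hits) and "2-primary part of the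
Tate|BSD formula at p = 2|prime 2 is excluded"
(3 noise hits); lean search 'def BSDp' / BC4 exact? over Mathlib + 19 Theses + X5 kernel (no theorem
of any crux shape).
Nearest prior art found: Kato2004Asterisque Thm 17.4 ([corpus:paper:url-79d6da346f06 p.158]: (2) at
all p incl. 2, (3) «p ≠ 2»);
Greenberg1999LNM Prop 5.14 ([corpus:book:coates1999-arithmetic-theory-elliptic-curves p.171], μ = 0
at 2 under a 2-torsion condition);
Matsuno2008 (2-adic λ under quadratic twist); Li2025TwoAdicMu (μ of two-variable 2-adic L over
imaginary quadratic K — CM-adjacent);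
instan  [refs: arxiv-2405.00270, paper:url-79d6da346f06, doi-10-4171-dm-450, arxiv-2404.05186, arxiv-2409.01350, book:coates1999-arithmetic-theory-elliptic-curves, Matsuno2008, Miller2011]

Barriers (technique_class: iwasawa-main-conjecture, p-adic-L, descent): - technique_class: iwasawa-main-conjecture, p-adic-L, descent
- Literature.Barriers.BirchSwinnertonDyer.ExceptionalZeroBarrier /
Literature.Barriers.BirchSwinnertonDyer.ExceptionalZeroBarrierNarrow: bites only the SPLIT branch of
19922/19923; evaded as in print via L♭ = L₂/T and the GS 𝓛-invariant (`LInvariant_ne_zero_holds`);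
GS@2 = displayed MEMO input. 19573/19577/19097/19098 outside.
- Literature.Barriers.BirchSwinnertonDyer.EisensteinMuBarrier (`mu_ne_zero`, hyp p ≠ 2): 19573
OrdKatoHalfAtTwoIso outside by hypothesis AND β is its printed evasion (2) — Kato half at SOME
isogenous minimal member (Gr99 Conj 1.11/Prop 5.14; transport
Theorems/ByReductionTypeAtTwoOrdKatoHalfIsogenyMu); 19577 μ-free (Ш-currency), outside.
- Literature.Barriers.BirchSwinnertonDyer.TwoDescentDefectUnbounded: 19577 OrdMissingLowerBoundAtTwo
INSIDE for per-class certificate rungs (574/609 certified; residue 35 = the barrier biting, dim Ш[2]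
unbounded: Kramer/Matsuno); the ∀ is reached only via an MC-type input (19272, aside) — declared,
not beaten. 19573/1992x outside.
- Literature.Barriers.BirchSwinnertonDyer.SelmerRankBarrier /
Literature.Barriers.BirchSwinnertonDyer.SelmerRankBarrierNarrow: not quantified over — no K4 crux
concludes a Mordell–Weil rank from a Selmer bound; r_an ∈ {0,1} is a HYPOTHESIS of every leaf and
the conclusion is BSD_2 (orders of Ш[2^∞] vs the 2-part of L(E,1)/Ω), r = 1 via GZK (the Narrow
escape clause).
- Literature.Barriers.BirchSwinnertonDyer.SignedIwasawaTheoryAtTwo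

History (route lifecycle, newest last):
- 2026-08-29T00:36:32Z · rev 32: restated OrdKatoIsoPrintBundleAtTwo (stmt-BirchSwinnertonDyer-23759) — P5′ (C): print bundle 23759 += Greenberg 1999 Prop 5.14@2 (aside AsideGreenbergProp514AtTwo); pen RC-362; lead cruxlead-19573 g4 (operator:999:616677)
- 2026-08-29T00:39:27Z · rev 33: restated OrdKatoFineZetaAtTwoResidue (stmt-BirchSwinnertonDyer-23760) — P5′ (A): F1⁽²⁾ ↦ F1μ re-cut (verbatim ZetaColemanMuInputsNegDiscAtTwo); pen RC-353/358/362; lead g4 (operator:999:838785)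
- 2026-08-29T00:42:36Z · rev 34: informal re-worded for OrdKatoIntSurjectiveAtTwo (operator:999:1043170)
- 2026-08-29T00:54:19Z · rev 36: restated OrdKatoMuPartOptimalAtTwo (stmt-BirchSwinnertonDyer-23780) — P5′ (B): B7 ↦ B7′ re-cut off the Prop 5.14 locus (verbatim KatoMuPartOff514AtOptimalMemberOfNotSurjectiveTwo); pen RC-362/RC-367; lead g4; triage r1-2 GEN 26 s5 (operator:999:1868557)
- 2026-08-29T01:38:30Z · rev 38: restated OrdKatoFineZetaAtTwoResidue (stmt-BirchSwinnertonDyer-23890) — P7 (F): F1μ ↦ F1μ⁺ sign-free re-cut (verbatim ZetaColemanMuInputsAtTwo); pen RC-370; lead cruxlead-19573 g5; w2 g0 finding (operator:999:712793)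
- 2026-08-29T01:41:47Z · rev 39: restated OrdKatoIntSurjectiveAtTwo (stmt-BirchSwinnertonDyer-23762) — P7 (C): B8 ↦ core⁺ = Core Theorem A on 0 < Δ (verbatim CoreTheoremAPosDiscTwo); decl name kept; pen RC-370; lead g5; w2 g0 (operator:999:988204)
- 2026-08-29T05:13:03Z · rev 41: restated OrdKatoFineZetaAtTwoResidue (stmt-BirchSwinnertonDyer-23959) — P8′: F1μ⁺ ↦ sign-split pair (F1μι⁻ ∧ OrdKatoHalfAtTwoIsoPosDisc), verbatim lead defs; forced-class revision (Negative lemma p691215, F-27a, Δ202-ι); decl kept; (operator:999:2941342)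
- 2026-08-30T13:52:30Z · rev 42: informal re-worded for stmt-BirchSwinnertonDyer-32821 (planner-bsd-f1-sign2-imc-g24-0)

sub-problem: BirchSwinnertonDyer · status: open · opened planner-bsd-2adic-plan-g9-0 2026-08-25T21:12:17Z · rev 43 · ledger route-BirchSwinnertonDyer-ByReductionTypeAtTwo
GENERATED by the gate from the ledger (D-0016/17). Provers cite these decls: `theorem foo : Summit.BirchSwinnertonDyer.BirchSwinnertonDyer.Theses.ByReductionTypeAtTwo.<Decl> := …` in Summits/BirchSwinnertonDyer/BirchSwinnertonDyer/Theorems/<Name>.lean.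
-/

namespace Summit.BirchSwinnertonDyer.BirchSwinnertonDyer.Theses.ByReductionTypeAtTwo

open scoped BigOperators Topology Manifold Classical MeasureTheory ProbabilityTheory Matrix InnerProductSpace ComplexConjugate ContinuousMap
open Filter Set Function TopologicalSpace MeasureTheory

attribute [summit_statement] _root_.BirchSwinnertonDyer
attribute [summit_statement] _root_.Summit.BirchSwinnertonDyer.BirchSwinnertonDyer.Rank1Residual.NonCMAtTwo

open Literature

/-- item stmt-BirchSwinnertonDyer-19095 · crux (kind.auto-crux: conjecture-grade) · rank 2 · SPLIT (gen 1) into OrdPublishedInputsAtTwo, OrdKatoHalfAtTwo, OrdEisensteinHalfAtTwo + glue GoodOrdinaryRankZeroAtTwoOfChildren · direct attempts still welcome (low priority) · by planner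
why it might fail: Kato 17.4(3) excludes p = 2: the μ-part of the divisibility at 2 is open off Greenberg's Prop 5.14 locus, μ ≥ 1 occurs on the 5.13 locus, and the Eisenstein lower bound at 2 has no printed source off the pinch habitats (83/611 census classes).
sources: Kato2004Asterisque, Greenberg1999LNM, GreenbergVatsal2000, Matsuno2008, SkinnerUrban2014, CastellaGrossiSkinner2025
retired/moot children: OrdKatoHalfAtTwo [replaced: Summit.BirchSwinnertonDyer.BirchSwinnertonDyer.Theorems.OrdHalvesAtTwo.OrdKatoHa]; OrdEisensteinHalfAtTwo [replaced: Summit.BirchSwinnertonDyer.BirchSwinnertonDyer.Theorems.OrdHalvesAtTwo.OrdEisens]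
[crux] for every non-CM elliptic curve E/ℚ (globally minimal W) of analytic rank 0 with good
ORDINARY reduction at 2, BSD₂(E) holds. Layer-2 objects already typed in the X5 kernel: μ-part of
Kato's divisibility at 2 `O1.KatoMuPartAtTwo` (⟺ `O1.MainConjectureLowerDivisibilityAtTwoOrd`,
p400656), tower gap `O1.TowerGapAtTwo` (p400624), Eisenstein lower bound
`O1.MainConjectureEisensteinDivisibilityAtTwo`; landed doors (34-CF) p400882, (34-GV) p402312, T-62
p400761, T-42 p402124. [difficulty: XL] -/
@[route_item "route-BirchSwinnertonDyer-ByReductionTypeAtTwo", crux]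
def GoodOrdinaryRankZeroAtTwo : Prop :=
  ∀ (W : WeierstrassCurve ℚ) [W.IsElliptic] [W.IsGloballyMinimal], ¬ W.HasCM → W.analyticRank = 0 → Literature.NumberTheory.EllipticCurves.Rank1Residual.GoodOrd W 2 → Literature.NumberTheory.EllipticCurves.BSDp W 2

-- parent: GoodOrdinaryRankZeroAtTwo · child (gen 1)
/--     item stmt-BirchSwinnertonDyer-19149 · support · rank 201 · open
    parent: GoodOrdinaryRankZeroAtTwo · by operator
    sources: BCDTJAMS2001, Kato2004Asterisque, GreenbergLNM1716, GrossZagier1986, Kolyvagin1990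
[support] The four PUBLISHED inputs of the class «non-CM, analytic rank 0, good ordinary at 2», as
ONE conjunction of the tree's Literature named facts (EisensteinPrimes `PublishedInputs` precedent,
stmt-BirchSwinnertonDyer-19037): modularity (BCDT 2001 Thm A: nonempty_modularParametrizationData),
Gross–Zagier–Kolyvagin (rank = analytic rank ≤ 1: rank_eq_analyticRank_of_analyticRank_le_one), Kato
2004 Thm 17.4 (1)(2) AT p = 2 for every such W and its newform (kato_divisibility_allPrimes W 2 —
clauses (1)(2) carry no parity hypothesis, p. 273), Greenberg 1999 Thm 4.1 parity-free
(Greenberg1999.thm41_charValue_rankZero_anyPrime; p = 2 carried by Lemmas 4.6/4.7/4.11, archimedean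
CAVEAT flag Gre99-Thm41-at-2-archimedean recorded in its module docstring). Provable-now means:
discharged conjunct by conjunct as `_holds` theorems land, else carried as displayed PUB hypotheses;
never counted as progress. [v1.3: typed through the landed constant
`Literature.Uncategorized.OrdPublishedInputsAtTwo` (VERBATIM the v1.1 statement; p414669 / p414934),
so the route file needs no `Summits.…Rank1Residual.X5.*` import.] -/
@[route_item "route-BirchSwinnertonDyer-ByReductionTypeAtTwo", crux]
def OrdPublishedInputsAtTwo : Prop :=
  Literature.Uncategorized.OrdPublishedInputsAtTwo

-- parent: GoodOrdinaryRankZeroAtTwo · child (gen 1)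
/--     item stmt-BirchSwinnertonDyer-19271 · aside · rank 202 · open
    parent: GoodOrdinaryRankZeroAtTwo · by planner
    why it might fail: Kato 17.4 (3) (integrality) prints p ≠ 2: 12.5 (4)/13.4 (3) lose a factor 2 (17.13: «exact up to ×2 when p = 2»), and μ(X) > 0 genuinely occurs at 2 (Greenberg 1999 §5), so 2^μ ∣ ϖ·L₂ is real content; one class with μ_an < μ_alg refutes it.
    sources: Kato2004Asterisque, GreenbergLNM1716, Wuthrich2014, GreenbergVatsal2000
[crux] The KATO–NÉRON half of the 2-adic cyclotomic main conjecture on the class «non-CM, analytic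
rank 0, good ordinary at 2»: for the cyclotomic ℤ₂-extension, the newform f, ϖ with ϖ·Ω_E = Ω⁺_f and
every dual datum, ϖ·L₂(f,α) = ι g for some g ∈ char_Λ X(E/ℚ_∞) — INTEGRALLY in Λ = ℤ₂⟦T⟧ (char X ∣
ϖ·L₂). Kato 17.4 (1)(2) gives it up to a power of 2 (in Λ[1/2]); modulo that PRINT and Néron
integrality it is EXACTLY the μ-part X5.O1.KatoMuPartAtTwo W (2^{μ(X)} ∣ ϖ·L₂;
X5/KatoOrdTwoMuPart.lean, katoMuPartAtTwo_of_… both directions landed). Gives MissingUpperBoundAt W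
2 via X5.O1.missingUpperBoundAt_two_of_mainConjectureLowerDivisibilityAtTwoOrd_of_kato. Typed
object: X5.O1.MainConjectureLowerDivisibilityAtTwoOrd (X5/TwoAdicTargetsMC.lean:62, guarded by
IsOrdinaryAt W 2). First rungs in the kernel: the 83 α-go classes (μ = 0 certified + λ-pinch,
X5/TwoAdicInstances*.lean) discharge it class by class modulo the image hypothesis. HABITAT SCOPE
(bsd-2adic-ord 23:37:48Z, recorded by the planner GEN 11): the X5 instance files certify this half
ONLY at the DISTINGUISHED (Greenberg Prop-5.14) member of each of the 83 classes (e.g.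
`X5.Instances.mazurMainConjecture_two_163785b2`); BSD(·,2) rea -/
@[route_item "route-BirchSwinnertonDyer-ByReductionTypeAtTwo", crux]
def OrdKatoHalfAtTwo : Prop :=
  ∀ (W : WeierstrassCurve ℚ) [W.IsElliptic] [W.IsGloballyMinimal], ¬ W.HasCM → W.analyticRank = 0 → Literature.NumberTheory.EllipticCurves.Rank1Residual.GoodOrd W 2 → Summit.BirchSwinnertonDyer.Rank1Residual.X5.O1.MainConjectureLowerDivisibilityAtTwoOrd W

-- parent: GoodOrdinaryRankZeroAtTwo · child (gen 1)
/--     item stmt-BirchSwinnertonDyer-19272 · aside · rank 203 · open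
    parent: GoodOrdinaryRankZeroAtTwo · by planner
    why it might fail: Every printed Eisenstein-congruence argument (Skinner–Urban U(2,2), Wan, CGS) needs p odd and ρ̄_{E,p} irreducible; at 2, ρ̄ is often reducible (rational 2-torsion: 3 427 of 5 295 classes) and μ > 0 occurs (Greenberg 5.13), so L₂ ∣ char X may need a genuinely new Euler-system/congruence input.
    sources: SkinnerUrban2014, Kato2004Asterisque, GreenbergLNM1716, CastellaGrossiSkinner2025, KellerYin2024
[crux] The EISENSTEIN (Skinner–Urban) half of the 2-adic cyclotomic main conjecture, Néron
normalisation, for EVERY non-CM E/ℚ good ordinary at 2 (rank-free): for the cyclotomic ℤ₂-extension,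
the newform f, ϖ with ϖ·Ω_E = Ω⁺_f, every dual datum and every generator f_X of char_Λ X(E/ℚ_∞): ι
f_X = ι h · ϖ·L₂(f,α) for some h ∈ ℤ₂⟦T⟧ (L₂ ∣ char X). Printed for odd p only (Skinner–Urban 2014
Thm 3.6.9/Conj. 3.6.8 need p odd and ρ̄ irreducible; Wan, CGS 2025, BCS, Keller–Yin keep p odd);
nothing in print or announced at p = 2. Shared verbatim by routes ByReductionTypeAtTwo (rank-0
formula side: gives MissingLowerBoundAt W 2 via X5.O1.missingLowerBoundAt_two_of_eisenstein_of_kato)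
and TwoAdicConverse (gives L(E,1) ≠ 0 from Sel finite via
entireLFunction_one_ne_zero_of_finite_selmer_of_facts_of_eisensteinAtTwo). Typed object:
X5.O1.MainConjectureEisensteinDivisibilityAtTwo (X5/TwoAdicTargetsEisenstein.lean:92, guarded by
IsOrdinaryAt W 2). HABITAT SCOPE (bsd-2adic-ord 23:37:48Z, recorded by the planner GEN 11): the X5
instance files certify this half ONLY at the DISTINGUISHED (Greenberg Prop-5.14) member of each of
the 83 classes (e.g. `X5.Instances.mazurMainConjecture_two_163785b2`); BSD( -/
@[route_item "route-BirchSwinnertonDyer-ByReductionTypeAtTwo", crux]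
def OrdEisensteinHalfAtTwo : Prop :=
  ∀ (W : WeierstrassCurve ℚ) [W.IsElliptic] [W.IsGloballyMinimal], ¬ W.HasCM → Literature.NumberTheory.EllipticCurves.Rank1Residual.GoodOrd W 2 → Summit.BirchSwinnertonDyer.Rank1Residual.X5.O1.MainConjectureEisensteinDivisibilityAtTwo W

-- parent: GoodOrdinaryRankZeroAtTwo · glue (gen 1)
/--     item stmt-BirchSwinnertonDyer-19152 · support · rank 204 · closed · proved by Summit.BirchSwinnertonDyer.BirchSwinnertonDyer.Theorems.goodOrdinaryRankZeroAtTwoOfChildren_proof (prover)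
    parent: GoodOrdinaryRankZeroAtTwo · GLUE: children ⟹ parent · by operator
[glue] GoodOrdinaryRankZeroAtTwo from its three children; ONE LINE from the landed PUB bridge
p409439 (Theorems/ByReductionTypeAtTwoGoodOrdinaryPub.lean): fun ⟨hmod, hGZK, h17, hGr⟩ hK hE =>
Theorems.goodOrdinaryRankZeroAtTwo_of_facts_of_halves hmod hGZK h17 hGr hK (fun W _ _ hcm _ hgo =>
hE W hcm hgo). Kernel-certified in plan/routes/split-g10/Sketch-S1.lean (farm rc 0, 0 sorry, axioms
propext/Classical.choice/Quot.sound). State the closing theorem with the FULLY-QUALIFIED type (gate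
dedup bug class 22:39Z). -/
@[route_item "route-BirchSwinnertonDyer-ByReductionTypeAtTwo"]
def GoodOrdinaryRankZeroAtTwoOfChildren : Prop :=
  OrdPublishedInputsAtTwo → OrdKatoHalfAtTwo → OrdEisensteinHalfAtTwo → GoodOrdinaryRankZeroAtTwo

-- `GoodOrdinaryRankZeroAtTwoOfChildren` holds: proved by `Summit.BirchSwinnertonDyer.BirchSwinnertonDyer.Theorems.goodOrdinaryRankZeroAtTwoOfChildren_proof` (its module imports this route file, so no `_holds` link can be stated here).

/-- item stmt-BirchSwinnertonDyer-19097 · crux · rank 4 · open · by planner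
why it might fail: Sprung2012 has ♯/♭ Coleman maps and signed Selmer groups at p = 2 (JNT 132 p.1486), but main conjectures, control and Kato-side divisibility are printed for odd p only (ibid. §7; Kobayashi2003; CCSS2018 «p ∤ N odd»): at 2 (a₂ ∈ {0, ±2}) no divisibility is typed; Kim's criterion is vacuous mod 2.
sources: Kobayashi2003, Sprung2012, Sprung2024, BDKim2013, CastellaCiperianiSkinnerSprung2018, Kurihara2002
[crux] for every non-CM E/ℚ (globally minimal W) of analytic rank 0 with good SUPERSINGULAR
reduction at 2 (a₂ ∈ {0, ±2}), BSD₂(E) holds. Layer-2 objects typed: `SS.KobayashiLowerDivisibility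
W 2 ε`, the Sprung pair `exists_isSprungPair_two`, consumer
`SS.bsdp_two_of_oneDivisibility_of_blindControl` (Supersingular/BlindControlTwo.lean). [difficulty:
XL] -/
@[route_item "route-BirchSwinnertonDyer-ByReductionTypeAtTwo", crux (experiment := "instrument: · stub_oddFlatValueLaw · stub_lowerOffGenericOdd), helper landings t42 GEN 50 p834068/p834163 + tower-1 GEN 68, door for stub 3 = D-imc-93 …") (source := "director BSD l.276, 2026-09-01")]
def SupersingularRankZeroAtTwo : Prop :=
  ∀ (W : WeierstrassCurve ℚ) [W.IsElliptic] [W.IsGloballyMinimal], ¬ W.HasCM → W.analyticRank = 0 → Literature.NumberTheory.EllipticCurves.Rank1Residual.GoodSS W 2 → Literature.NumberTheory.EllipticCurves.BSDp W 2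

/-- item stmt-BirchSwinnertonDyer-19098 · crux · rank 5 · SPLIT (gen 1) into FineSelmerConjAAtTwoAdditivePotGood, AdditivePotGoodReducibleRestAtTwo, AdditivePotGoodLowerHalfAtTwo, AdditivePotMultOverKAtTwo, AdditivePrintedInputsAtTwo + glue AdditiveRankZeroAtTwoSplitGlue · direct attempts still welcome (low priority) · by planner
why it might fail: no Selmer condition or 2-adic L-function at an additive 2 exists in print; 781 of the 1 945 census classes acquire semistable reduction only over wildly ramified extensions of ℚ₂ where no descent/transfer is typed (Delbourgo1998 needs p ≥ 5).
sources: Delbourgo1998, Matsuno2008, GreenbergVatsal2000, Kato2004Asterisque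
[crux] for every non-CM E/ℚ (globally minimal W) of analytic rank 0 with ADDITIVE reduction at 2,
BSD₂(E) holds. Layer-2 objects typed: the L2 doors (p400731), the K*-road (p401880/p401883), the
twist pinch `AddTwoL2Pinch.bsdp_two_of_twistPinch` (p404266) with Matsuno2008 Thm 5.1 at the
ramified twist (p404073): BSD₂ of the additive curve from the Iwasawa theory of its semistable
quadratic twist over ℚ_∞. [difficulty: XL] -/
@[route_item "route-BirchSwinnertonDyer-ByReductionTypeAtTwo", crux]
def AdditiveRankZeroAtTwo : Prop :=
  ∀ (W : WeierstrassCurve ℚ) [W.IsElliptic] [W.IsGloballyMinimal], ¬ W.HasCM → W.analyticRank = 0 → Literature.NumberTheory.EllipticCurves.Rank1Residual.Addv W 2 → Literature.NumberTheory.EllipticCurves.BSDp W 2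

-- parent: AdditiveRankZeroAtTwo · child (gen 1)
/--     item stmt-BirchSwinnertonDyer-22615 · crux · rank 501 · open
    parent: AdditiveRankZeroAtTwo · by operator
    why it might fail: C1″ ⟺ μ₂ = 0 of the fine Selmer dual over ℚ_cyc for additive pot-good curves with S₃ (non-abelian) 2-division field: no class-group/Iwasawa criterion at p = 2 (Ferrero–Washington needs abelian), μ > 0 excluded by no census; kit j319764: doors close 14/44 window classes, C1″-RES open on 30/44.
    sources: CoatesSujatha2005, Conj. A, Lim2017FineSelmer, Thm. 3.5, Kato2004Asterisque, Thm. 12.4, FerreroWashington1979, GreenbergLNM1716, §4, Summits/BirchSwinnertonDyer/BirchSwinnertonDyer/Theorems (p675411 unique-prime door, p676651 inert door, p676188 `fineSelmerConjAAtTwoAdditivePotGoodResidual` C1″-RES)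
[crux · = binder hAna of addL2x GEN 11 p627985 `AddKatoTwo.additiveRankZeroAtTwo_of_residual_v4`
VERBATIM fq] Coates–Sujatha Conjecture A at p = 2 (fine Selmer dual finitely generated over ℤ₂ along
the cyclotomic ℤ₂-extension) for the non-CM analytic-rank-0 curves ADDITIVE and POTENTIALLY GOOD at
2 (0 ≤ ord₂ j) whose 2-division field is NOT abelian over ℚ; the abelian case is a theorem from
print (p621123: Lim 2017 Thm 3.5@2 + Ferrero–Washington). Feeds the Kato half at 2 (p627985
`addPotGoodUpper_two_of_conjA_of_rest`). -/
@[route_item "route-BirchSwinnertonDyer-ByReductionTypeAtTwo"]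
def FineSelmerConjAAtTwoAdditivePotGood : Prop :=
  ∀ (W : WeierstrassCurve ℚ) [W.IsElliptic] [W.IsGloballyMinimal], ¬ W.HasCM → W.analyticRank = 0 → Literature.NumberTheory.EllipticCurves.Rank1Residual.Addv W 2 → 0 ≤ padicValRat 2 W.j → ¬ IsAbelianGalois ℚ (W.divisionField 2) → ∀ (κ : Literature.NumberTheory.EllipticCurves.ZpExtension ℚ 2), κ.IsCyclotomic → ∃ (γ : Field.absoluteGaloisGroup ℚ) (D : W.FineSelmerDualData κ γ), Module.Finite (PadicInt 2) (RestrictScalars (PadicInt 2) (Literature.NumberTheory.EllipticCurves.IwasawaAlgebra 2) D.X)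

-- parent: AdditiveRankZeroAtTwo · child (gen 1)
/--     item stmt-BirchSwinnertonDyer-22617 · crux · rank 503 · open
    parent: AdditiveRankZeroAtTwo · by operator
    why it might fail: No Euler-system-free lower bound is known at p = 2 for additive reduction: the Skinner–Urban / Wan main-conjecture halves exclude p = 2 and additive primes, and Greenberg–Vatsal-type congruence arguments need ordinary or multiplicative reduction.
    sources: SkinnerUrban2014, Kato2004, Wan2020RankinSelberg
[crux · = binder hLow of p627985 `_v4` VERBATIM fq · the EISENSTEIN / LOWER half] the missing LOWER
bound at 2 (ord₂ of the algebraic side ≥ ord₂ of the analytic side of BSD) for every non-CM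
analytic-rank-0 curve additive and potentially good at 2 — over ℚ, no auxiliary quadratic field;
p627985 `addPotGood_bsdp_two_iff_lower_of_kato` certifies this is EXACTLY what the crux asserts on
that class beyond the Kato half. The additive twin of K4's ordinary lower-half crux
`OrdMissingLowerBoundAtTwo` (19577). -/
@[route_item "route-BirchSwinnertonDyer-ByReductionTypeAtTwo"]
def AdditivePotGoodLowerHalfAtTwo : Prop :=
  ∀ (W : WeierstrassCurve ℚ) [W.IsElliptic] [W.IsGloballyMinimal], ¬ W.HasCM → W.analyticRank = 0 → Literature.NumberTheory.EllipticCurves.Rank1Residual.Addv W 2 → 0 ≤ padicValRat 2 W.j → Literature.NumberTheory.EllipticCurves.Rank1Residual.Typed.MissingLowerBoundAt W 2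

-- parent: AdditiveRankZeroAtTwo · child (gen 1)
/--     item stmt-BirchSwinnertonDyer-22618 · crux · rank 504 · open
    parent: AdditiveRankZeroAtTwo · by operator
    why it might fail: The C-part of BSD₂ for E/K (K ramified at 2, twist multiplicative above 2, r_an = 0) needs Tamagawa/period bookkeeping at a ramified even place not in print; descent K → ℚ can lose a factor 2; after NST′ the upper half stays open on split-twist reducible and irreducible pot-mult curves.
    sources: Milne1972ArithmeticAV, Thm. 1, HoffsteinLuo1997, Kato2004Asterisque, Thm. 12.5 (3), (12.5.1), Conj. 12.10, Prop. 14.16 (2), Summits/BirchSwinnertonDyer/BirchSwinnertonDyer/Theorems/ByReductionTypeAtTwoAdditiveReducibleKatoMemberSharpNST.lean (p674406 `addPotMultNST_reducibleUpper_two_sharp`), Summits/BirchSwinnertonDyer/BirchSwinnertonDyer/Theorems/ByReductionTypeAtTwoAdditiveRankZeroResidualV9.lean (p674625)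
[crux · = binder hQKm of p627985 `_v4` VERBATIM fq] the C-part of BSD₂ over a quadratic field K
semistabilising W at 2, RESTRICTED to the POTENTIALLY MULTIPLICATIVE additive curves (ord₂ j < 0;
463 classes): with Milne's Weil-restriction quotient (any model), Hoffstein–Luo and the sibling
`MultiplicativeRankZeroAtTwo` BY NAME this gives BSD₂ over ℚ on that class (p627985
`addPotMult_bsdp_two_of_mult_of_overKC`). Lane A's over-K stub, narrowed. -/
@[route_item "route-BirchSwinnertonDyer-ByReductionTypeAtTwo"]
def AdditivePotMultOverKAtTwo : Prop :=
  ∀ (W : WeierstrassCurve ℚ) [W.IsElliptic] [W.IsGloballyMinimal], ¬ W.HasCM → W.analyticRank = 0 → Literature.NumberTheory.EllipticCurves.Rank1Residual.Addv W 2 → padicValRat 2 W.j < 0 → ∀ (K : Type) [Field K] [NumberField K], Module.finrank ℚ K = 2 → Summit.BirchSwinnertonDyer.Rank1Residual.X5.AddTwoL2.SemistableTwistAtTwo W K → (W.quadraticTwist (NumberField.discr K : ℚ)).entireLFunction 1 ≠ 0 → Summit.BirchSwinnertonDyer.Rank1Residual.AdditivePotMult.MissingPPartOverCAt (W.baseChange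 K) 2

-- parent: AdditiveRankZeroAtTwo · child (gen 1)
/--     item stmt-BirchSwinnertonDyer-22616 · support · rank 502 · open
    parent: AdditiveRankZeroAtTwo · by operator
    why it might fail: Kato's divisibility at the member loses control of the 2-part when an isogenous curve has 4-torsion (the 13.10 multiplier and the Manin-constant/isogeny bookkeeping at 2 are not sharp) — the upper bound may genuinely fail to transfer along a 4-isogeny.
    sources: Kato2004Asterisque, Thm. 12.4–12.6, (12.5.1), 13.10, 13.13, Thm. 14.5, §14.8, Prop. 14.16 (2), GreenbergLNM1716, Prop. 4.13, MazurRubin2004, Thm. 2.3.4, Lim2017FineSelmer, Thm. 3.5, FerreroWashington1979, Cassels1965ArithmeticVIII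
[crux · = binder hRest of p627985 `_v4` VERBATIM fq] the missing UPPER half at 2 on the
E[2]-REDUCIBLE additive potentially-good rank-0 curves OFF Kato's member sub-block (an isogenous
member with 4 ∣ #tors, or ord₂Ш_an odd); on the sub-block it is p624850's theorem (member package
p624448, D-audit hMH2@2 PASS). Census j306106 (defect ≥ 3): 9 / 210 reducible classes (BIGTORS
31200bc … 496320w); pot-good scope adds the C₂/defect-<3 reducible classes failing the side
conditions. -/
@[route_item "route-BirchSwinnertonDyer-ByReductionTypeAtTwo"]
def AdditivePotGoodReducibleRestAtTwo : Prop :=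
  ∀ (W : WeierstrassCurve ℚ) [W.IsElliptic] [W.IsGloballyMinimal], ¬ W.HasCM → W.analyticRank = 0 → Literature.NumberTheory.EllipticCurves.Rank1Residual.Addv W 2 → 0 ≤ padicValRat 2 W.j → ¬ W.HasIrreducibleModPGaloisRep 2 → ¬ ((∀ (W' : WeierstrassCurve ℚ) [W'.IsElliptic], WeierstrassCurve.IsIsogenous W W' → ¬ 2 ^ 2 ∣ W'.torsionOrder) ∧ (∀ q : ℚ, Literature.NumberTheory.EllipticCurves.shaAn W = (q : ℂ) → Even (padicValRat 2 q))) → Literature.NumberTheory.EllipticCurves.Rank1Residual.Typed.MissingUpperBoundAt W 2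

-- parent: AdditiveRankZeroAtTwo · child (gen 1)
/--     item stmt-BirchSwinnertonDyer-22619 · support · rank 505 · open
    parent: AdditiveRankZeroAtTwo · by operator
    sources: GrossZagier1986, Kolyvagin1990, BreuilConradDiamondTaylor2001, Milne1972ArithmeticAV, HoffsteinLuo1997, MurtyMurty1997
[support · published inputs BY NAME, 11 heads = the print binders of p627985 `_v4`]
Gross–Zagier–Kolyvagin rank ≤ 1 ∧ modularity (entire L-function over ℚ; newform) ∧ Milne 1972 Weil
restriction (any model) ∧ Hoffstein–Luo twist ∧ Lim 2017 Thm 3.5 at 2 ∧ Ferrero–Washington ∧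
Kato-at-2 SHARP reading (D-audit PASS) ∧ Kato member package at 2 (p624448, D-audit hMH2@2 PASS) ∧
Cassels isogeny invariance ∧ Cassels–Tate pairing over ℚ. (Murty–Murty@2 is no longer consumed by
the additive glue.) -/
@[route_item "route-BirchSwinnertonDyer-ByReductionTypeAtTwo"]
def AdditivePrintedInputsAtTwo : Prop :=
  Literature.NumberTheory.EllipticCurves.rank_eq_analyticRank_of_analyticRank_le_one ∧ WeierstrassCurve.hasEntireLFunction_rat ∧ Literature.NumberTheory.EllipticCurves.Milne1972.bsdQuotient_baseChange_quadratic_anyModel ∧ Literature.NumberTheory.EllipticCurves.HoffsteinLuo1997_exists_twist_L_one_ne_zero ∧ Literature.NumberTheory.EllipticCurves.Lim2017.thm35_at_two_fineSelmerDual_moduleFinite_of_classicalMuVanishes_of_le_divisionField_four ∧ Literature.NumberTheory.IwasawaTheory.ferreroWashington1979_classicalMuVanishes ∧ Literature.NumberTheory.EllipticCurves.Kato2004.rankZero_padicValNat_sha_add_padicValNat_tamagawa_le_at_two_of_irreducible_of_fineSelmerDual_fg ∧ Literature.NumberTheory.EllipticCurves.ModularForms.exists_isNewformOf ∧ Literature.NumberTheory.EllipticCurves.Kato2004.exists_memberHullInputs_two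 ∧ WeierstrassCurve.bsdRHS_eq_of_isIsogenous ∧ WeierstrassCurve.exists_casselsTate_pairing (K := ℚ)

-- parent: AdditiveRankZeroAtTwo · glue (gen 1)
/--     item stmt-BirchSwinnertonDyer-22620 · support · rank 506 · open
    parent: AdditiveRankZeroAtTwo · GLUE: children ⟹ parent · by operator
additive block split v2.2 (one-sided) along addL2x p627985 additiveRankZeroAtTwo_of_residual_v4:
AdditivePrintedInputsAtTwo → MultiplicativeRankZeroAtTwo → FineSelmerConjAAtTwoAdditivePotGood →
AdditivePotGoodReducibleRestAtTwo → AdditivePotGoodLowerHalfAtTwo → AdditivePotMultOverKAtTwo →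
AdditiveRankZeroAtTwo; proof READY pub/bsd-2adic/plan/split-19098/v22/glue-19098-landing-v2_2.lean -/
@[route_item "route-BirchSwinnertonDyer-ByReductionTypeAtTwo"]
def AdditiveRankZeroAtTwoSplitGlue : Prop :=
  FineSelmerConjAAtTwoAdditivePotGood → AdditivePotGoodReducibleRestAtTwo → AdditivePotGoodLowerHalfAtTwo → AdditivePotMultOverKAtTwo → AdditivePrintedInputsAtTwo → AdditiveRankZeroAtTwo

/-- item stmt-BirchSwinnertonDyer-19099 · crux · rank 6 · SPLIT (gen 1) into RankOneAtTwoBigImageOddLocal, RankOneAtTwoOffBigImageOddLocal + glue RankOneAtTwoGlue · direct attempts still welcome (low priority) · by planner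
why it might fail: Kolyvagin's index bound carries an unspecified power of 2 (GrigorovJorzaPatrikisSteinTarnita2009 «p odd»), the p-adic Waldspurger/BDP leading-term formula behind JetchevSkinnerWan2017 is printed for odd good p only, and nothing exists at additive 2.
sources: JetchevSkinnerWan2017, GrossZagier1986, Kolyvagin1990, GrigorovJorzaPatrikisSteinTarnita2009, Zhang2014
[crux] for every non-CM E/ℚ (globally minimal W) of analytic rank exactly 1 (any reduction at 2),
BSD₂(E) holds — the 2-part of the Gross–Zagier–Kolyvagin index identity. Declared tribunal RESIDUAL
of the route (rank axis r = 1; typed object `O1.RankOneIndexIdentityAtTwo`, exact per-pair door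
`P2.bsdp_two_iff_of_heegner_rankOne`). [difficulty: XL] -/
@[route_item "route-BirchSwinnertonDyer-ByReductionTypeAtTwo", crux]
def RankOneAtTwo : Prop :=
  ∀ (W : WeierstrassCurve ℚ) [W.IsElliptic] [W.IsGloballyMinimal], ¬ W.HasCM → W.analyticRank = 1 → Literature.NumberTheory.EllipticCurves.BSDp W 2

-- parent: RankOneAtTwo · child (gen 1)
/--     item stmt-BirchSwinnertonDyer-23715 · crux · rank 601 · open
    parent: RankOneAtTwo · by operator
    why it might fail: The first-Kolyvagin-layer law at p = 2 (exact 2-power in the Kolyvagin/Kato index bound) is in print for odd p only (GrossZagier–Kolyvagin index carries an unspecified power of 2; JSW2017/Zhang2014 need p odd); big image + odd local terms may not remove the 2-adic Manin-constant ambiguity.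
    sources: Kolyvagin1990, GrossZagier1986, JetchevSkinnerWan2017, Zhang2014, GrigorovJorzaPatrikisSteinTarnita2009
[crux] W-42 (β) SLICE of RankOneAtTwo for the F1Sign2 Euler-system first-Kolyvagin-layer line (fkl):
non-CM E/ℚ of analytic rank 1 with SURJECTIVE mod-2^n Galois representation for every n (big 2-adic
image), ODD torsion order and ODD Tamagawa product ⇒ BSD₂(E). Text verbatim from bsd-f1-sign2-es g3
(SplitGlue-19099.lean 431e507dfa4a4763); pre-vet PASS bsd-vet-tk5c g0 (n = 0 conjunct provably true,
slice satisfiable: 37.a1). [difficulty: XL] -/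
@[route_item "route-BirchSwinnertonDyer-ByReductionTypeAtTwo"]
def RankOneAtTwoBigImageOddLocal : Prop :=
  ∀ (W : WeierstrassCurve ℚ) [W.IsElliptic] [W.IsGloballyMinimal], ¬ W.HasCM → (∀ n : ℕ, W.HasSurjectiveModNGaloisRep ((2 ^ n : ℕ) : ℤ)) → Odd W.torsionOrder → Odd W.tamagawaProduct → W.analyticRank = 1 → Literature.NumberTheory.EllipticCurves.BSDp W 2

-- parent: RankOneAtTwo · child (gen 1)
/--     item stmt-BirchSwinnertonDyer-23716 · crux · rank 602 · open
    parent: RankOneAtTwo · by operator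
    why it might fail: Contains every rank-1 non-CM curve with rational 2-torsion, even Tamagawa product or non-surjective 2-adic image — exactly where the 2-part of the GZK index identity is unknown and where Ш[2]/descent interact with the Manin constant; nothing in print at p = 2.
    sources: Kolyvagin1990, GrossZagier1986, JetchevSkinnerWan2017, Zhang2014, GrigorovJorzaPatrikisSteinTarnita2009
[crux] W-42 (β) COMPLEMENT (honest residue): non-CM E/ℚ of analytic rank 1 OFF the slice — NOT (big
2-adic image ∧ odd torsion ∧ odd Tamagawa) ⇒ BSD₂(E). No line declared; every classical 2-adic
obstruction (rational 2-torsion, even Tamagawa numbers, small 2-adic image) lives here. Text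
verbatim from bsd-f1-sign2-es g3 (SplitGlue-19099.lean 431e507dfa4a4763). [difficulty: XL] -/
@[route_item "route-BirchSwinnertonDyer-ByReductionTypeAtTwo"]
def RankOneAtTwoOffBigImageOddLocal : Prop :=
  ∀ (W : WeierstrassCurve ℚ) [W.IsElliptic] [W.IsGloballyMinimal], ¬ W.HasCM → ¬ ((∀ n : ℕ, W.HasSurjectiveModNGaloisRep ((2 ^ n : ℕ) : ℤ)) ∧ Odd W.torsionOrder ∧ Odd W.tamagawaProduct) → W.analyticRank = 1 → Literature.NumberTheory.EllipticCurves.BSDp W 2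

-- parent: RankOneAtTwo · glue (gen 1)
/--     item stmt-BirchSwinnertonDyer-23717 · support · rank 603 · closed · proved by Summit.BirchSwinnertonDyer.BirchSwinnertonDyer.Theorems.byReductionTypeAtTwo_rankOneAtTwoGlue_proof (planner)
    parent: RankOneAtTwo · GLUE: children ⟹ parent · by operator
RankOneAtTwoBigImageOddLocal → RankOneAtTwoOffBigImageOddLocal → RankOneAtTwo — by cases on the
slice conjunction; proof READY pub/bsd-f1-sign2/data-es/SplitGlue-19099.lean 431e507dfa4a4763 -/
@[route_item "route-BirchSwinnertonDyer-ByReductionTypeAtTwo"]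
def RankOneAtTwoGlue : Prop :=
  RankOneAtTwoBigImageOddLocal → RankOneAtTwoOffBigImageOddLocal → RankOneAtTwo

-- `RankOneAtTwoGlue` holds: proved by `Summit.BirchSwinnertonDyer.BirchSwinnertonDyer.Theorems.byReductionTypeAtTwo_rankOneAtTwoGlue_proof` (its module imports this route file, so no `_holds` link can be stated here).

/-- item stmt-BirchSwinnertonDyer-23932 · crux · rank 7 · open · by operator
why it might fail: Kolyvagin's conjecture at 2 is open (Zhang 2014 needs p ≥ 5: mod-p multiplicity one and level raising fail at 2); for v₂(c) > 0 a non-optimal / even-constant parametrisation may break the exact exponent; one certified Sel₂-trivial minimal door with m ≠ v₂(c) refutes it.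
sources: Zhang2014CJM, Thm. 1.1 (p ≥ 5; shape), GrossLMS1991, Conj. 1.2, §3, §10, GrossZagier1986, Thm. I.6.3, V.§2, Kramer1981, Prop. 3, Prop. 6, KrizLi2019, Rem. 1.14 (p-converse at p = 2 not known), Summits/BirchSwinnertonDyer/BirchSwinnertonDyer/Theorems/ByReductionTypeAtTwoRankOneAtTwoOneDoorLawFirstLayerDefs.lean (HeegnerExponentAtSelmerTrivialMinimalDoorAtTwo; heegnerNonDivisibilityMinimalDoor_of_heegnerExponent)
[crux · top-level slot 7 · PROMOTED STUB R₀⁺ of child 23715 `RankOneAtTwoBigImageOddLocal`'s LINE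
v8.17 one_door_analytic (`stub_heegnerExponent`, fkl-p1 g16 verdict promote-stub; precedent:
19573/19577 = promoted stubs 202/203)] Kolyvagin's conjecture at 2, SIGN-FREE and Manin-free first
layer: for W/ℚ globally minimal, non-CM, ρ_{W,2^n} onto ∀ n, odd torsion, odd Tamagawa product,
analytic rank 1, Ш(W)[2] = 0, and K imaginary quadratic door-admissible with the door MINIMAL (t +
2s = [Δ_W < 0]), (d_K, N_W) = 1, Heegner hypothesis, #Sel₂(W^{(d_K)}/ℚ) = 1: for ANY parametrisation
datum of level N_W (constant c) the exact 2-divisibility exponent of the Heegner point modulo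
torsion is v₂(c). Declared BY NAME (head constant = the @[conjecture] leaf
`RankOneAtTwoOneDoor.HeegnerExponentAtSelmerTrivialMinimalDoorAtTwo`,
Theorems/ByReductionTypeAtTwoRankOneAtTwoOneDoorLawFirstLayerDefs.lean; rev-11 idiom). In the
skeleton-aware cone of the load-bearing child 23715 (the first-layer locus closes BY NAME through
`bsdp_two_of_heegnerExponent_firstLayer`); co-ownable by TwoAdicConverse / -an (AN-13′, AN-22K) by
filing the same name. Unconditional door supply (`exists_selmerTrivialMinimalDoor`); -/
@[route_item "route-BirchSwinnertonDyer-ByReductionTypeAtTwo"]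
def RankOneHeegnerExponentFirstLayerAtTwo : Prop :=
  Summit.BirchSwinnertonDyer.BirchSwinnertonDyer.Theorems.RankOneAtTwoOneDoor.HeegnerExponentAtSelmerTrivialMinimalDoorAtTwo

/-- item stmt-BirchSwinnertonDyer-19573 · crux · rank 202 · SPLIT (gen 1) into OrdKatoIsoPrintBundleAtTwo, OrdKatoFineZetaAtTwoResidue, OrdKatoMuPartOptimalAtTwo, OrdKatoIntSurjectiveAtTwo + glue OrdKatoHalfAtTwoIsoOfChildren · direct attempts still welcome (low priority) · by planner
why it might fail: Kato's divisibility at p = 2 is exact only up to ×2 (Kato §17.13) and μ(X) > 0 occurs at 2 off the Prop-5.14 member; even the best member of a class with E[2] irreducible may have no integral Kato divisibility in print (17.4(3) needs p odd) — the TOWER/GVI certificates must supply it class by class.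
sources: GreenbergLNM1716 Prop 5.13/5.14, p.170, Kato2004Asterisque Thm 17.4, plan/tribunal/CERT-19271-witness-163785b.md
retired/moot children: OrdKatoIsoPrintBundleAtTwo [replaced: Literature.Uncategorized.OrdPublishedInputsAtTwo ∧ Literature.NumberTheory.Ellip]; OrdKatoFineZetaAtTwoResidue [replaced: ∀ (W : WeierstrassCurve ℚ) [W.IsElliptic] [W.IsGloballyMinimal] [ContinuousSMul ]; OrdKatoMuPartOptimalAtTwo [replaced: Summit.BirchSwinnertonDyer.BirchSwinnertonDyer.Theorems.OrdKatoOptimalAtTwo.Kato]; OrdKatoIntSurjectiveAtTwo [replaced: Summit.BirchSwinnertonDyer.BirchSwinnertonDyer.Theorems.OrdKatoIntAtTwo.KatoIntA]; OrdKatoMuPartOptimalAtTwo [replaced: ∀ (W : WeierstrassCurve ℚ) [W.IsElliptic] [W.IsGloballyMinimal], ¬ W.HasCM → Lit]; OrdKatoFineZetaAtTwoResidue [replaced: ∀ (W : WeierstrassCurve ℚ) [W.IsElliptic] [W.IsGloballyMinimal] [ContinuousSMul ]; OrdKatoFineZetaAtTwoResidue [replaced: ∀ (W : WeierstrassCurve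 ℚ) [W.IsElliptic] [W.IsGloballyMinimal] [ContinuousSMul ]
[crux, rank 202] The Kato direction ϖ·L₂ ∈ char_Λ X of the 2-adic cyclotomic IMC at SOME globally
minimal member of the ℚ-isogeny class of every non-CM, analytic-rank-0, good-ordinary-at-2 curve
(repaired 19271: the ∀-member form additionally asserts Greenberg's conjecture μ_E = m_E at 2 at
non-distinguished members, LNM 1716 p. 170; BSD₂ is isogeny-invariant so the route needs one
member). Implied by 19271 (ordKatoHalfAtTwoIso_of_ordKatoHalfAtTwo). -/
@[route_item "route-BirchSwinnertonDyer-ByReductionTypeAtTwo", crux]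
def OrdKatoHalfAtTwoIso : Prop :=
  ∀ (W : WeierstrassCurve ℚ) [W.IsElliptic] [W.IsGloballyMinimal], ¬ W.HasCM → W.analyticRank = 0 → Literature.NumberTheory.EllipticCurves.Rank1Residual.GoodOrd W 2 → ∃ (W' : WeierstrassCurve ℚ) (_ : W'.IsElliptic) (_ : W'.IsGloballyMinimal), WeierstrassCurve.IsIsogenous W W' ∧ Summit.BirchSwinnertonDyer.Rank1Residual.X5.O1.MainConjectureLowerDivisibilityAtTwoOrd W'

-- parent: OrdKatoHalfAtTwoIso · child (gen 1)
/--     item stmt-BirchSwinnertonDyer-24097 · crux · rank 20202 · open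
    parent: OrdKatoHalfAtTwoIso · by operator
    why it might fail: Δ<0: Kato 12.5(4)/13.4(3)/17.11 at p = 2 under ρ̄₂ onto only are beyond print and may lose a factor 2. 0<Δ: reduces (Thm C, paper) to Conj A at 2 for a non-abelian S₃×C₂ division field; false at any rectangular curve with μ(X₀^rel∞) ≥ 1.
    sources: Kato2004Asterisque, Thm 12.4–12.6, Thm 13.4, Thm 16.2/16.6, Thm 17.4, Prop 17.11, (14.9.3), §17.13 (pp. 221–222, 240, 269–273, 277, 279–280), GreenbergLNM1716, Lemma 4.6 (pp. 105–107), Conj. 1.11, Summits/BirchSwinnertonDyer/BirchSwinnertonDyer/Theorems/ByReductionTypeAtTwoOrdKatoHalfAtTwoIsoPosDiscDefs.lean (lead g5) + …ZetaColemanMuIotaChain.lean (w3 p691807) + …ZetaColemanMuIotaDoor.lean (w3 p690167), Summits/BirchSwinnertonDyer/BirchSwinnertonDyer/Theorems/OrdKatoHalfAtTwoIso/Negative/ZetaColemanMuTwoDivisible.lean (p691215) + lead finding F-27a (LEAD-FINDING-F27a-posDisc.md e32933e05cb2)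
[crux] F1 slot of crux 202 as a SIGN-SPLIT PAIR (P8′ forced-class revision after Negative lemma
p691215 + F-27a + Δ202-ι; director (337)/(338)): CELL Δ < 0 — F1μι⁻ = Kato's zeta classes in Coleman
coordinates at 2 with the column map τ ι-SEMILINEAR (ι = IwasawaAlgebra.involEquiv 2, the honest
keying of the local Tate pairing), Z inside the span of genuine 2-adic Euler-system classes, image
clause at (2); Kato-witnessed on rhombic period lattices at memo tier (γ₁^∨ booked exactly, ‖r‖₂ =
1); verbatim `SteinbergFibreAtTwo.ZetaColemanMuIotaNegDiscAtTwo` (lead g5). ∧ CELL 0 < Δ ∧ ρ̄₂ onto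
— `SteinbergFibreAtTwo.OrdKatoHalfAtTwoIsoPosDisc` = the parent's conclusion (Kato lower
divisibility at an isogenous minimal curve) on that cell, where the line's Euler-system mechanism is
void as typed (every genuine class lies in 2·𝐇¹_Γ in the R∞ world; CoreA⁺ 23967 proved-but-idle);
conjecture-grade content = Coates–Sujatha Conjecture A at p = 2 on the rectangular good-ordinary
habitat + the span-free Coleman reading, up to the real-signature bit R∞ (TRIAGE-r1-2 GEN 32 Thm C,
refuter-grade paper; S₃×C₂ division field — Ferrero–Washington/Lim do not apply). RESEARCH; a
reading of Kato §§12–17 at 2, -/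
@[route_item "route-BirchSwinnertonDyer-ByReductionTypeAtTwo"]
def OrdKatoFineZetaAtTwoResidue : Prop :=
  (∀ (W : WeierstrassCurve ℚ) [W.IsElliptic] [W.IsGloballyMinimal] [ContinuousSMul (PadicInt 2) (W.tateModule 2)] [Module.Free (PadicInt 2) (W.tateModule 2)] [Module.Finite (PadicInt 2) (W.tateModule 2)] {N : ℕ} [NeZero N] (f : CuspForm (Subgroup.map (Matrix.SpecialLinearGroup.mapGL ℝ) (CongruenceSubgroup.Gamma0 N)) 2) (κ : Literature.NumberTheory.EllipticCurves.ZpExtension ℚ 2) (γ : Field.absoluteGaloisGroup ℚ) (hκ : κ.IsCyclotomic), Literature.NumberTheory.EllipticCurves.IsOrdinaryAt W 2 → W.HasSurjectiveModNGaloisRep 2 → W.Δ < 0 → κ.IsTopGenerator γ → Literature.NumberTheory.EllipticCurves.IsCyclotomicVariable 2 γ → Literature.NumberTheory.EllipticCurves.ModularForms.IsNewformOf W f → ∀ (D : W.SelmerDualData κ γ) (Y : W.FineSelmerDualData κ γ), ∃ (I : Literature.NumberTheory.EllipticCurves.Kato2004.IwasawaH1Data W 2 κ γ) (Z : Submodule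 (Literature.NumberTheory.EllipticCurves.IwasawaAlgebra 2) I.H) (P : Submodule (Literature.NumberTheory.EllipticCurves.IwasawaAlgebra 2) (Literature.NumberTheory.EllipticCurves.IwasawaAlgebra 2)) (ℓ : I.H →ₗ[Literature.NumberTheory.EllipticCurves.IwasawaAlgebra 2] P) (τ : P →ₛₗ[((Literature.NumberTheory.EllipticCurves.IwasawaAlgebra.involEquiv 2).toRingEquiv : Literature.NumberTheory.EllipticCurves.IwasawaAlgebra 2 →+* Literature.NumberTheory.EllipticCurves.IwasawaAlgebra 2)] D.X) (π : D.X →ₗ[Literature.NumberTheory.EllipticCurves.IwasawaAlgebra 2] Y.X), Z ≤ Submodule.span (Literature.NumberTheory.EllipticCurves.IwasawaAlgebra 2) {s : I.H | Literature.NumberTheory.EllipticCurves.Kato2004.IsEulerSystemClassTwo W hκ I s} ∧ (∀ z ∈ Z, τ (ℓ z) = 0) ∧ Function.Surjective π ∧ Function.Exact τ π ∧ ∀ G₁ : Literature.NumberTheory.EllipticCurves.IwasawaAlgebra 2, Literature.NumberTheory.EllipticCurves.iwasawaToPowerSeries 2 G₁ = Literature.NumberTheory.EllipticCurves.padicLFunction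 f (Literature.NumberTheory.EllipticCurves.unitRoot W 2 : ℚ_[2]) → ∃ s : Literature.NumberTheory.EllipticCurves.IwasawaAlgebra 2, s ∉ Literature.NumberTheory.EllipticCurves.IwasawaAlgebra.augIdealP 2 ∧ s * G₁ ∈ Submodule.map (P.subtype ∘ₗ ℓ) Z) ∧ (∀ (W : WeierstrassCurve ℚ) [W.IsElliptic] [W.IsGloballyMinimal], ¬ W.HasCM → W.analyticRank = 0 → Literature.NumberTheory.EllipticCurves.Rank1Residual.GoodOrd W 2 → W.HasSurjectiveModNGaloisRep 2 → 0 < W.Δ → ∃ (W' : WeierstrassCurve ℚ) (_ : W'.IsElliptic) (_ : W'.IsGloballyMinimal), WeierstrassCurve.IsIsogenous W W' ∧ Summit.BirchSwinnertonDyer.Rank1Residual.X5.O1.MainConjectureLowerDivisibilityAtTwoOrd W')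

-- parent: OrdKatoHalfAtTwoIso · child (gen 1)
/--     item stmt-BirchSwinnertonDyer-23921 · crux · rank 20203 · open
    parent: OrdKatoHalfAtTwoIso · by operator
    why it might fail: Off the optimal member μ_E > m_E happens at 2 (Greenberg 1999 §5); Wuthrich's integrality is printed for p odd only; off the 5.14 locus a member with μ-part AND an integral lift of ϖ·L₂ may not exist if the Manin constant or c_∞ = 2 eats the last factor 2.
    sources: GreenbergLNM1716, Props 2.2, 2.4, 5.14, §5 (p. 170), Wuthrich2014, Thm 16, Lemma 14, Prop 15 (p odd), Kato2004Asterisque, Thm 12.4, 12.6, 16.6 (2), 17.4 (1)(2), Prop 17.11, Summits/BirchSwinnertonDyer/BirchSwinnertonDyer/Theorems/ByReductionTypeAtTwoOrdKatoHalfAtTwoIsoOptimalOff514Defs.lean (p679274)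
[crux B7′ — re-cut off Greenberg's Prop 5.14 locus (cruxlead-19573 g4 (B); pen RC-360)] for W
non-CM, good ordinary at 2, ρ̄₂ NOT onto: some isogenous globally minimal W′ carries (the Kato
μ-part package `X5.O1.KatoMuPartAtTwo W′` OR a rational 2-torsion point that is ramified-at-2 XOR
odd — there μ = 0 is PRINT by Greenberg 1999 Prop 5.14, aside `AsideGreenbergProp514AtTwo`) AND an
integral Iwasawa lift L₀ of ϖ·L₂(f, unit root) for every newform/period normalisation of W′.
VERBATIM the body of `SteinbergFibreAtTwo.KatoMuPartOff514AtOptimalMemberOfNotSurjectiveTwo`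
(p679274; Iff.rfl certificates: lead `…_restate_23780.lean` commit b3cb9b6d602d, pen
plan/recut-19573/CertRecutGlueBranches.lean); filed B7 ⟹ B7′
(`katoMuPartOff514_of_katoMuPartAtOptimalMember`), B7′ ∧ 5.14 ⟹ filed B7
(`katoMuPartAtOptimalMember_of_prop514_of_off514`). Optional finer split later (p680193): reducible
part `KatoMuPartOff514ReducibleTwo` + C₃ part `KatoMuPartIrrNotSurjectiveTwo`. TRIAGE-r1-2 gen 22:
the 5.14 locus covers 392/665 small reducible classes.
 SHARPEN s52 (cruxtriage-19573-2 GEN 26, TRIAGE-r1-2.md commit 6ced243b3351): the reducible disjunct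
is beyond print EXACTLY on the «5.14-silent» classes ( -/
@[route_item "route-BirchSwinnertonDyer-ByReductionTypeAtTwo"]
def OrdKatoMuPartOptimalAtTwo : Prop :=
  ∀ (W : WeierstrassCurve ℚ) [W.IsElliptic] [W.IsGloballyMinimal], ¬ W.HasCM → Literature.NumberTheory.EllipticCurves.Rank1Residual.GoodOrd W 2 → ¬ W.HasSurjectiveModNGaloisRep 2 → ∃ (W' : WeierstrassCurve ℚ) (_ : W'.IsElliptic) (_ : W'.IsGloballyMinimal), WeierstrassCurve.IsIsogenous W W' ∧ (Summit.BirchSwinnertonDyer.Rank1Residual.X5.O1.KatoMuPartAtTwo W' ∨ ∃ x y : ℚ, W'.toAffine.Equation x y ∧ 2 * y + W'.a₁ * x + W'.a₃ = 0 ∧ ((Literature.NumberTheory.EllipticCurves.Greenberg1999.TwoTorsionRamifiedAtTwo x ∧ ¬ Literature.NumberTheory.EllipticCurves.Greenberg1999.TwoTorsionOdd W' x) ∨ (Literature.NumberTheory.EllipticCurves.Greenberg1999.TwoTorsionOdd W' x ∧ ¬ Literature.NumberTheory.EllipticCurves.Greenberg1999.TwoTorsionRamifiedAtTwo x))) ∧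 ∀ [NeZero (W'.conductorNorm ℤ)] (f : CuspForm (CongruenceSubgroup.Gamma0 (W'.conductorNorm ℤ)) 2), Literature.NumberTheory.EllipticCurves.ModularForms.IsNewformOf W' f → ∀ ϖ : ℚ, (ϖ : ℝ) * W'.realPeriodRat = Literature.NumberTheory.EllipticCurves.ModularForms.plusPeriod f → ∃ L₀ : Literature.NumberTheory.EllipticCurves.IwasawaAlgebra 2, Literature.NumberTheory.EllipticCurves.iwasawaToPowerSeries 2 L₀ = PowerSeries.C (ϖ : ℚ_[2]) * Literature.NumberTheory.EllipticCurves.padicLFunction f (Literature.NumberTheory.EllipticCurves.unitRoot W' 2 : ℚ_[2])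

-- parent: OrdKatoHalfAtTwoIso · child (gen 1)
/--     item stmt-BirchSwinnertonDyer-23967 · crux · rank 20204 · closed · proved by Summit.BirchSwinnertonDyer.BirchSwinnertonDyer.Theorems.SteinbergFibreAtTwo.ordKatoIntSurjectiveAtTwo_proof (prover)
    parent: OrdKatoHalfAtTwoIso · by operator
    why it might fail: Core Theorem A on 0 < Δ = Heegner–Kolyvagin at the REAL place (c_∞ = 2): Mazur–Rubin/Rubin assume p > 2 at ∞; it fails if the Kolyvagin class's real component leaves the Kummer line (c−1)E[4], exactly where no q ≡ 1 (4) primes help.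
    sources: Kato2004Asterisque, Thm 12.6 (p. 222), §13.8 (p. 228), MazurRubin2004KolyvaginSystems; Rubin2000EulerSystems (p > 2 at the archimedean place), Summits/BirchSwinnertonDyer/BirchSwinnertonDyer/Theorems/ByReductionTypeAtTwoOrdKatoHalfAtTwoIsoKatoIntSignFreeDoor.lean (p682426) + …CoreSignFreeOfKolyvagin.lean (p682357) + …RubinTauAtTwo.lean (p682874), pub/bsd-2adic memo MEMO-6 (c_∞ = 2; audit-2 PASS, memo tier)
[crux core⁺ — Core Theorem A on 0 < Δ (cruxlead-19573 g5 P7, replacing B8 «Kato 17.4 (3)-type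
integrality» whose Δ < 0 half FOLLOWS from F1μ and whose 0 < Δ half is DERIVED from F1μ⁺ + core⁺ in
the kernel: w2 p682357/p682426, lead `katoIntAtGoodOrdSurjectiveTwo_of_signFree`)] for W globally
minimal, good ordinary at 2, ρ̄₂ onto, 0 < Δ, cyclotomic (κ, γ), Kato's 𝐇¹_Γ(T₂W): a genuine 2-adic
Euler-system class not divisible by 2 ⟹ some (conj_γ − id)^J kills every H¹(ℚ_∞, E[2])-class landing
in Sel₀(ℚ_∞, E[2^∞]). VERBATIM the body of `SteinbergFibreAtTwo.CoreTheoremATwoResidue` (p655368)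
with `W.Δ < 0` replaced by `0 < W.Δ` (= `SteinbergFibreAtTwo.CoreTheoremAPosDiscTwo`, lead g5; sha16
b5a5102f49862cab). Its Δ < 0 twin is the THEOREM p669276; T1, the sign-free H-C (p681540) and the
count are theorems, so the beyond-kernel content is exactly H-K⁺ at the real place (∞-Lagrangian on
the Kummer line (c−1)E[4]; q ≡ 1 (4) transposition Kolyvagin primes via Rubin's τ p682874; on this
habitat ρ_{E,2^∞} is onto for free (triage r1-2 s54, `twoAdicSurjective_of_goodOrd_two_of_pos_disc`)
and DD12 ⊂ {Δ < 0} is the proved half p669276). MEMO-6 c_∞ = 2 in kernel form. Decl name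
`OrdKatoIntSurjective -/
@[route_item "route-BirchSwinnertonDyer-ByReductionTypeAtTwo"]
def OrdKatoIntSurjectiveAtTwo : Prop :=
  ∀ (W : WeierstrassCurve ℚ) [W.IsElliptic] [W.IsGloballyMinimal] [ContinuousSMul (PadicInt 2) (W.tateModule 2)] [Module.Free (PadicInt 2) (W.tateModule 2)] [Module.Finite (PadicInt 2) (W.tateModule 2)] (κ : Literature.NumberTheory.EllipticCurves.ZpExtension ℚ 2) (γ : Field.absoluteGaloisGroup ℚ) (I : Literature.NumberTheory.EllipticCurves.Kato2004.IwasawaH1Data W 2 κ γ) (hκ : κ.IsCyclotomic), W.HasGoodReductionAtPrime 2 → ¬ (2 : ℤ) ∣ W.frobeniusTrace 2 → W.HasSurjectiveModNGaloisRep 2 → 0 < W.Δ → κ.IsTopGenerator γ → (∃ s : I.H, Literature.NumberTheory.EllipticCurves.Kato2004.IsEulerSystemClassTwo W hκ I s ∧ s ∉ Literature.NumberTheory.EllipticCurves.IwasawaAlgebra.augIdealP 2 • (⊤ : Submodule (Literature.NumberTheory.EllipticCurves.IwasawaAlgebra 2) I.H)) → ∃ J : ℕ, ∀ y : Literature.NumberTheory.EllipticCurves.subgroupH1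 κ.kerSubgroup (WeierstrassCurve.geomTorsion W (2 : ℤ)), W.torsionToPrimaryH1Sub 2 κ.kerSubgroup y ∈ W.fineSelmerInfty κ → (⇑(Literature.NumberTheory.EllipticCurves.conjH1 κ.kerSubgroup (WeierstrassCurve.geomTorsion W (2 : ℤ)) γ - AddMonoidHom.id (Literature.NumberTheory.EllipticCurves.subgroupH1 κ.kerSubgroup (WeierstrassCurve.geomTorsion W (2 : ℤ)))))^[J] y = 0

-- `OrdKatoIntSurjectiveAtTwo` holds: proved by `Summit.BirchSwinnertonDyer.BirchSwinnertonDyer.Theorems.SteinbergFibreAtTwo.ordKatoIntSurjectiveAtTwo_proof` (its module imports this route file, so no `_holds` link can be stated here).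

-- parent: OrdKatoHalfAtTwoIso · child (gen 1)
/--     item stmt-BirchSwinnertonDyer-23889 · support · rank 20201 · open
    parent: OrdKatoHalfAtTwoIso · by operator
    sources: AbbesUllmo1996, Thm A, Kato2004Asterisque, Thm 17.4, BCDTJAMS2001
[support · PRINT bundle, re-cut (cruxlead-19573 g4 (C))] the published inputs of the good-ordinary
block (`Literature.Uncategorized.OrdPublishedInputsAtTwo`: modularity / Kato 17.4 divisibility h17 /
GZK / …, = item 19149 by name) ∧ Abbes–Ullmo 1996 Thm A (p ∤ N ⇒ p ∤ Manin constant) ∧ Greenberg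
1999 Prop 5.14 at 2 (μ = 0 and cotorsion for a ramified-xor-odd rational 2-torsion point; aside
`AsideGreenbergProp514AtTwo`). First child of the split of crux 202; with the re-cut children F1μ /
B7′ / B8 the split glue closes BY NAME by `SteinbergFibreAtTwo.ordKatoHalfAtTwoIso_of_recut_cite`
(p679274; pen certificate plan/recut-19573/CertRecutGlueBranches.lean branch_S3). -/
@[route_item "route-BirchSwinnertonDyer-ByReductionTypeAtTwo"]
def OrdKatoIsoPrintBundleAtTwo : Prop :=
  Literature.Uncategorized.OrdPublishedInputsAtTwo ∧ Literature.NumberTheory.EllipticCurves.ModularForms.abbesUllmo_not_dvd_maninConstant_of_not_dvd_level ∧ Literature.NumberTheory.EllipticCurves.Greenberg1999.prop514_isTorsion_mu_eq_zero_two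

-- parent: OrdKatoHalfAtTwoIso · glue (gen 1)
/--     item stmt-BirchSwinnertonDyer-23763 · support · rank 20205 · closed · proved by Summit.BirchSwinnertonDyer.BirchSwinnertonDyer.Theorems.ordKatoHalfAtTwoIsoOfChildren_proof (prover)
    parent: OrdKatoHalfAtTwoIso · GLUE: children ⟹ parent · by operator
[glue · split of crux 202 `OrdKatoHalfAtTwoIso` (stmt-19573) into PRINT bundle + the three
beyond-print inputs of Kato's divisibility at good-ordinary 2 (LINE steinberg_fibre_at_two sockets
F1⁽²⁾ / B7 / B8; LEAD cruxlead-19573 lineage, p669276 `ordKatoHalfAtTwoIso_of_memo_cite` /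
`ordKatoHalfAtTwoIso_of_sockets`) — CLOSES BY NAME AT ONCE: pen certificate
plan/split-19573-19577/ClosingOrdKatoHalfAtTwoIsoOfChildren.lean
(`ordKatoHalfAtTwoIsoOfChildren_text`, farm rc 0 / 0 sorry)] OrdKatoIsoPrintBundleAtTwo →
OrdKatoFineZetaAtTwoResidue → OrdKatoMuPartOptimalAtTwo → OrdKatoIntSurjectiveAtTwo →
OrdKatoHalfAtTwoIso. A K4-ACL prover files
Theorems/ByReductionTypeAtTwoOrdKatoHalfAtTwoIsoOfChildren.lean with the certificate's term. -/
@[route_item "route-BirchSwinnertonDyer-ByReductionTypeAtTwo"]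
def OrdKatoHalfAtTwoIsoOfChildren : Prop :=
  OrdKatoIsoPrintBundleAtTwo → OrdKatoFineZetaAtTwoResidue → OrdKatoMuPartOptimalAtTwo → OrdKatoIntSurjectiveAtTwo → OrdKatoHalfAtTwoIso

-- `OrdKatoHalfAtTwoIsoOfChildren` holds: proved by `Summit.BirchSwinnertonDyer.BirchSwinnertonDyer.Theorems.ordKatoHalfAtTwoIsoOfChildren_proof` (its module imports this route file, so no `_holds` link can be stated here).

/-- item stmt-BirchSwinnertonDyer-19577 · crux · rank 203 · SPLIT (gen 1) into OrdMLBPrintBundleAtTwo, OrdLambdaHalfAtTwo + glue OrdMissingLowerBoundAtTwoOfChildren · direct attempts still welcome (low priority) · by planner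
why it might fail: As a ∀-statement it is BSD₂'s Ш-lower half at every rank-0 good-ordinary non-CM curve, open at p = 2: off the 609 X5 classes certified by descent records (574 at level (2,2) PARI+CT-2; 35 at (4,2) sha-1 F+G, X5/LevelRecordsG{,9}) only an IMC input (μ = 0 at 2) bounds ord₂ #Ш[2^∞] below.
sources: GreenbergLNM1716 Thm 4.1, Prop 5.13/5.14, Kato2004Asterisque Thm 17.4, pub/bsd-2adic/ord3/CENSUS-19577.md @6dab3c16404dd11a (descent side 609/609; descent-cert-609.tsv @12ca6d8bcaa71bd7), pub/bsd-2adic/CERT-CT2-X5ALL.md @52ed3a030080f04c (RC-39), Summits/BirchSwinnertonDyer/Rank1Residual/X5/LevelRecordsG.lean + LevelRecordsG9.lean (gM = 0 rows), pub/bsd-2adic/ord3/CENSUS-19272.md v2 @490f4c0d8ec288e5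
[crux, rank 203] For every non-CM, analytic-rank-0, good-ordinary-at-2, globally minimal E/ℚ: the
ONE missing descent inequality ord₂ #Ш_an(E) ≤ ord₂ #Ш(E)[2^∞] (`MissingLowerBoundAt W 2`; alias of
the closed leaf p429628, `ordMissingLowerBoundAtTwo_iff` = Iff.rfl). Replaces the shared ∀-crux
19272 `OrdEisensteinHalfAtTwo` in K4's cone: granted PUB (19149) and the Kato half (19271),
Eisenstein half ⟺ 2-adic MC ⟺ BSD₂ ⟺ this inequality at each such curve (ord-3 GEN 2,
Theorems.EisensteinShaCurrency.*), and it is isogeny-invariant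
(`missingLowerBoundAt_of_isIsogenous`). Implied by 19272 given 19149 (Sketch-K6
`ordMissingLowerBoundAtTwo_of_ordEisensteinHalfAtTwo`). CERTIFIED per class by 2-descent +
Cassels–Tate (PARI `ellrank`, kit j251284/j251635) on 574/609 rank-0 good-ordinary X5 classes
(CENSUS-19272.md v2 @490f4c0d8ec288e5); residue 35 classes with ord₂ #Ш_an ≥ 6 (8-descent). -/
@[route_item "route-BirchSwinnertonDyer-ByReductionTypeAtTwo", crux]
def OrdMissingLowerBoundAtTwo : Prop :=
  Summit.BirchSwinnertonDyer.BirchSwinnertonDyer.Theorems.OrdHalvesAtTwo.OrdMissingLowerBoundAtTwo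

-- parent: OrdMissingLowerBoundAtTwo · child (gen 1)
/--     item stmt-BirchSwinnertonDyer-19556 · crux · rank 20302 · open
    parent: OrdMissingLowerBoundAtTwo · by planner
    why it might fail: λ_an ≤ λ_alg at p = 2 is the Euler-system-free (Eisenstein-ideal) direction: Skinner–Urban needs p odd ∧ E[p] irreducible; nothing in print at 2. For E[2] reducible, λ moves along 2-isogenies only via μ; a class with λ(L₂) > λ(X) at every member refutes it (none known; tower d_j tables test it).
    sources: GreenbergVatsal2000 p.4, SkinnerUrban2014, Thm 3.29 (p odd), Summits/BirchSwinnertonDyer/BirchSwinnertonDyer/Theses/TwoAdicConverse.lean (stmt-BirchSwinnertonDyer-19556), Summits/BirchSwinnertonDyer/BirchSwinnertonDyer/Theorems/ByReductionTypeAtTwoKatoFreeSandwichAssembly.lean (p668589)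
[crux, rank 202] The λ-HALF of the 2-adic cyclotomic main conjecture on the class «non-CM, good
ordinary at 2»: for every such globally minimal W, its cyclotomic data, newform and Selmer dual
data, some nonzero integral rational multiple L₀ of L₂(f,α) has λ(L₀) ≤ λ(X(W/ℚ_∞))
(Greenberg–Vatsal's λ_an ≤ λ_alg; μ-free, period-free). STRICTLY WEAKER than the shared Eisenstein
half 19272 (which adds μ_an ≤ μ_alg + slack, ord-3
`ordEisensteinHalfAtTwo_iff_forall_lam_le_and_mu_le`); with PUB (19167) it yields 19218 by conv-1's
bridge p424885 `goodOrdinaryRankZeroTwoConverse_of_forall_lam_le`. By NAME the p425465 constant. Not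
in print at p = 2. -/
@[route_item "route-BirchSwinnertonDyer-ByReductionTypeAtTwo", crux]
def OrdLambdaHalfAtTwo : Prop :=
  ∀ (W : WeierstrassCurve ℚ) [W.IsElliptic] [W.IsGloballyMinimal], ¬ W.HasCM → Literature.NumberTheory.EllipticCurves.Rank1Residual.GoodOrd W 2 → ∀ (κ : Literature.NumberTheory.EllipticCurves.ZpExtension ℚ 2) (γ : Field.absoluteGaloisGroup ℚ), κ.IsCyclotomic → κ.IsTopGenerator γ → Literature.NumberTheory.EllipticCurves.IsCyclotomicVariable 2 γ → Literature.NumberTheory.EllipticCurves.IsOrdinaryAt W 2 → ∀ [NeZero (W.conductorNorm ℤ)] (f : CuspForm (CongruenceSubgroup.Gamma0 (W.conductorNorm ℤ)) 2), Literature.NumberTheory.EllipticCurves.ModularForms.IsNewformOf W f → ∀ (D : W.SelmerDualData κ γ), ∃ (c : ℚ) (L₀ : Literature.NumberTheory.EllipticCurves.IwasawaAlgebra 2), L₀ ≠ 0 ∧ Literature.NumberTheory.EllipticCurves.iwasawaToPowerSeries 2 L₀ = PowerSeries.C (c : ℚ_[2]) * Literature.NumberTheory.EllipticCurves.padicLFunction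 f (Literature.NumberTheory.EllipticCurves.unitRoot W 2 : ℚ_[2]) ∧ Summit.BirchSwinnertonDyer.Rank1Residual.X1.MuLambda.lam L₀ ≤ D.lambda

-- parent: OrdMissingLowerBoundAtTwo · child (gen 1)
/--     item stmt-BirchSwinnertonDyer-23764 · support · rank 20301 · open
    parent: OrdMissingLowerBoundAtTwo · by operator
    sources: Stevens1989, §2, ConradEdixhovenStein2003, §6.1, AbbesUllmo1996, Thm A, Cassels1965
[support · PRINT BUNDLE, BY NAME — never a prover target] `OrdPublishedInputsAtTwo` (item 19149 by
name) ∧ Cassels isogeny-invariance of the BSD quotient (`WeierstrassCurve.bsdRHS_eq_of_isIsogenous`,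
first conjunct of item 19567) ∧ Abbes–Ullmo (AU) ∧ Stevens/CES optimal Γ₁-parametrisation data
(`exists_optimal_gamma1ParametrizationData`, T2 [Stevens1989 §2; ConradEdixhovenStein2003 §6.1]).
First child of the split of crux 203 `OrdMissingLowerBoundAtTwo` so that the split glue is closable
from p668589 `KatoFreeSandwich.ordMissingLowerBoundAtTwo_of_published_of_lambdaHalf` (pen
certificate `plan/split-19573-19577/ClosingOrdMissingLowerBoundAtTwoOfChildren.lean`, farm rc 0). -/
@[route_item "route-BirchSwinnertonDyer-ByReductionTypeAtTwo"]
def OrdMLBPrintBundleAtTwo : Prop :=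
  Literature.Uncategorized.OrdPublishedInputsAtTwo ∧ WeierstrassCurve.bsdRHS_eq_of_isIsogenous ∧ Literature.NumberTheory.EllipticCurves.ModularForms.abbesUllmo_not_dvd_maninConstant_of_not_dvd_level ∧ Literature.NumberTheory.EllipticCurves.ModularForms.exists_optimal_gamma1ParametrizationData

-- parent: OrdMissingLowerBoundAtTwo · glue (gen 1)
/--     item stmt-BirchSwinnertonDyer-23765 · support · rank 20303 · closed · proved by Summit.BirchSwinnertonDyer.BirchSwinnertonDyer.Theorems.KatoFreeSandwich.ordMissingLowerBoundAtTwoOfChildren_proof (prover)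
    parent: OrdMissingLowerBoundAtTwo · GLUE: children ⟹ parent · by operator
[glue · split of crux 203 `OrdMissingLowerBoundAtTwo` (stmt-19577) into PRINT bundle + the λ-half
`OrdLambdaHalfAtTwo` (= S3 TwoAdicConverse item stmt-19556 VERBATIM, LINE
kato_free_lower_sandwich_two, p668589
`KatoFreeSandwich.ordMissingLowerBoundAtTwo_of_published_of_lambdaHalf`) — CLOSES BY NAME AT ONCE:
pen certificate plan/split-19573-19577/ClosingOrdMissingLowerBoundAtTwoOfChildren.lean
(`ordMissingLowerBoundAtTwoOfChildren_text`, farm rc 0 / 0 sorry)] OrdMLBPrintBundleAtTwo →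
OrdLambdaHalfAtTwo → OrdMissingLowerBoundAtTwo. A K4-ACL prover (19577 g4 successor has it
pre-built) files Theorems/ByReductionTypeAtTwoOrdMissingLowerBoundAtTwoOfChildren.lean. -/
@[route_item "route-BirchSwinnertonDyer-ByReductionTypeAtTwo"]
def OrdMissingLowerBoundAtTwoOfChildren : Prop :=
  OrdMLBPrintBundleAtTwo → OrdLambdaHalfAtTwo → OrdMissingLowerBoundAtTwo

-- `OrdMissingLowerBoundAtTwoOfChildren` holds: proved by `Summit.BirchSwinnertonDyer.BirchSwinnertonDyer.Theorems.KatoFreeSandwich.ordMissingLowerBoundAtTwoOfChildren_proof` (its module imports this route file, so no `_holds` link can be stated here).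

/-- item stmt-BirchSwinnertonDyer-19096 · support · rank 3 · SPLIT (gen 1) into MultPublishedInputsAtTwo, MultUpperHalfAtTwo, MultLowerHalfAtTwo + glue MultiplicativeRankZeroAtTwoOfChildren · direct attempts still welcome (low priority) · by planner
why it might fail: the lower (Eisenstein-side) divisibility for the Mazur–Tate–Teitelbaum L̃ at a multiplicative 2 has no printed source, Kato's integral clause at 2 ∣ N is reached only ⊗ℚ, and at split 2 the exceptional zero forces a derivative formula known in print for p ≥ 5 only.
sources: Skinner2016PacificMC, GreenbergStevens1993, Kato2004Asterisque, Matsuno2008, Greenberg1999LNM, Delbourgo2008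
[crux] for every non-CM E/ℚ (globally minimal W) of analytic rank 0 with MULTIPLICATIVE reduction at
2 (split or non-split), BSD₂(E) holds. Layer-2 objects typed: `O1.KatoMultiplicativeDivisibilityRat
W 2` (p400711), `O1.MultLowerDivisibilityAtTwoRat` (p402103), Greenberg–Stevens at 2
(p401547/p402114), twist doors (34-TW-mult) p403141/p403509/p403815. [difficulty: XL] -/
@[route_item "route-BirchSwinnertonDyer-ByReductionTypeAtTwo", crux]
def MultiplicativeRankZeroAtTwo : Prop :=
  ∀ (W : WeierstrassCurve ℚ) [W.IsElliptic] [W.IsGloballyMinimal], ¬ W.HasCM → W.analyticRank = 0 → Literature.NumberTheory.EllipticCurves.Rank1Residual.Mult W 2 → Literature.NumberTheory.EllipticCurves.BSDp W 2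

-- parent: MultiplicativeRankZeroAtTwo · child (gen 1)
/--     item stmt-BirchSwinnertonDyer-19922 · crux · rank 302 · open
    parent: MultiplicativeRankZeroAtTwo · by operator
    why it might fail: At p ∣ N Kato's divisibility is printed only in Λ⊗ℚ (17.13 via Kobayashi 2006); integrality needs μ = 0 and ord₂ ϖ ≥ 0 class-wide, but μ(X) > 0 occurs at 2 (Greenberg 1999 §5, rational 2-isogenies) and ϖ may have negative 2-adic valuation, so on those classes no Euler-system bound is in reach.
    sources: Kato2004Asterisque, Kobayashi2006DocMath, GreenbergLNM1716, GreenbergStevens1993, Miller2011LMS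
[crux] The EULER-SYSTEM (upper) half on the class «non-CM, analytic rank 0, multiplicative at 2»:
ord₂ #Ш(E/ℚ) ≤ ord₂ #Ш_an(E) (Typed.MissingUpperBoundAt W 2, Miller 2011 Def 1.1 currency). Known
road (bsd-2adic-mult, bridge multiplicativeRankZeroAtTwo_of_muRoad p409679): Kato 17.4/17.13 ⊗ℚ at a
multiplicative 2 (memo PROOF-MULT.md, referee RC-2 PASS; typed
X5.O1.KatoMultiplicativeDivisibilityRat) + Greenberg's Thm-4.1 analogues at non-split/split 2
(PRINT, parity-free) + Greenberg–Stevens at a split 2 (memo PROOF-GS2.md, RC-4 PASS) + the OPEN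
class-wide inputs μ(X(E/ℚ_∞)) = 0 and 2-adic period integrality ord₂ ϖ ≥ 0; per class it is
discharged by certificates (μ_an = 0, λ-pinch): 1/1 976 classes CLOSED (158774g, p407940), 142
GV-mult + 19 TW-mult DOOR-READY at evidence tier (HOME TARGET v1.18 line 2). -/
@[route_item "route-BirchSwinnertonDyer-ByReductionTypeAtTwo", crux]
def MultUpperHalfAtTwo : Prop :=
  ∀ (W : WeierstrassCurve ℚ) [W.IsElliptic] [W.IsGloballyMinimal], ¬ W.HasCM → W.analyticRank = 0 → Literature.NumberTheory.EllipticCurves.Rank1Residual.Mult W 2 → Literature.NumberTheory.EllipticCurves.Rank1Residual.Typed.MissingUpperBoundAt W 2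

-- parent: MultiplicativeRankZeroAtTwo · child (gen 1)
/--     item stmt-BirchSwinnertonDyer-19923 · crux · rank 303 · open
    parent: MultiplicativeRankZeroAtTwo · by operator
    why it might fail: ∀-level absent in print at p=2: printed non-degenerate lower bounds (ord₂#Ш_an ≥ 2) need p odd ∧ ρ̄ irreducible (SU14/Kato); at 2 only twist families with Ш[2^∞]_an trivial (Zhai 2016; Cai–Li–Zhai 2019: X₀(14), 34A1) + the integrality direction (Zhai 2025); 4 K=4 classes need CT on Sel₈.
    sources: arXiv:1409.0231, arXiv:1712.01271, SkinnerUrban2014, KatoAsterisque295 Thm 17.4, evidence-19923-gen4-print-at-2.md (item evidence, mult-3 GEN 4)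
[crux] The MAIN-CONJECTURE (lower) half on the class «non-CM, analytic rank 0, multiplicative at 2»:
ord₂ #Ш_an(E) ≤ ord₂ #Ш(E/ℚ) (Typed.MissingLowerBoundAt W 2). It is the Eisenstein direction L₂ ∣
char X of the cyclotomic main conjecture at a MULTIPLICATIVE 2 (non-split: ordinary-type; split:
with the trivial zero, Greenberg–Stevens 𝓛-invariant), read through Greenberg's Thm-4.1 analogues;
printed only for odd p (Skinner–Urban 2014 §3.6; Skinner 2016 multiplicative reduction, p odd; BCS
2024/25 keep p odd). The road's binder hlow in multiplicativeRankZeroAtTwo_of_muRoad (p409679) is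
exactly this statement per pair; no kernel instance discharges it except via the 2-CONVERSE twin +
numerical BSD on CLOSED classes (158774g). -/
@[route_item "route-BirchSwinnertonDyer-ByReductionTypeAtTwo", crux]
def MultLowerHalfAtTwo : Prop :=
  ∀ (W : WeierstrassCurve ℚ) [W.IsElliptic] [W.IsGloballyMinimal], ¬ W.HasCM → W.analyticRank = 0 → Literature.NumberTheory.EllipticCurves.Rank1Residual.Mult W 2 → Literature.NumberTheory.EllipticCurves.Rank1Residual.Typed.MissingLowerBoundAt W 2

-- parent: MultiplicativeRankZeroAtTwo · child (gen 1)
/--     item stmt-BirchSwinnertonDyer-19921 · support · rank 301 · open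
    parent: MultiplicativeRankZeroAtTwo · by operator
    sources: GrossZagier1986, Kolyvagin1990, Miller2011LMS
[support] The one PUBLISHED input the halves-glue consumes: Gross–Zagier–Kolyvagin, rank = analytic
rank for analytic rank ≤ 1 with Ш finite (tree named fact
rank_eq_analyticRank_of_analyticRank_le_one; used by bsdp_of_missingPPartAt to turn Miller's last
clause into BSD(E,2)). Carried as a displayed PUB hypothesis; never counted as progress. The further
PRINT of the roads to the two halves (Greenberg Thm-4.1 analogues at a multiplicative prime
thm41Analogue_charValue_rankZero_numberField_anyPrime / …_split_baseChange_anyPrime, modularity) and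
the referee-passed MEMO inputs (Kato ⊗ℚ at a multiplicative 2:
X5.O1.KatoMultiplicativeDivisibilityRat W 2, HOME mult/PROOF-MULT.md RC-2; Greenberg–Stevens at 2:
greenberg_stevens W 2, mult/PROOF-GS2.md RC-4) enter the LINES under the halves (bridge
multiplicativeRankZeroAtTwo_of_muRoad, p409679), not this glue. -/
@[route_item "route-BirchSwinnertonDyer-ByReductionTypeAtTwo", crux]
def MultPublishedInputsAtTwo : Prop :=
  Literature.NumberTheory.EllipticCurves.rank_eq_analyticRank_of_analyticRank_le_one

-- parent: MultiplicativeRankZeroAtTwo · glue (gen 1)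
/--     item stmt-BirchSwinnertonDyer-19924 · support · rank 304 · closed · proved by Summit.BirchSwinnertonDyer.BirchSwinnertonDyer.Theorems.multiplicativeRankZeroAtTwoOfChildren_holds (prover)
    parent: MultiplicativeRankZeroAtTwo · GLUE: children ⟹ parent · by operator
[glue] MultiplicativeRankZeroAtTwo from its three children; ONE application of the landed bridge
p409679 (Theorems/ByReductionTypeAtTwoMultiplicativeInputs.lean): fun hGZK hU hL =>
Theorems.multiplicativeRankZeroAtTwo_of_halves hGZK hU hL. Kernel-certified in
plan/routes/split-g10/Sketch-S3.lean (farm rc 0, 0 sorry, axioms trio). FULLY-QUALIFIED type in the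
closing theorem. -/
@[route_item "route-BirchSwinnertonDyer-ByReductionTypeAtTwo", crux]
def MultiplicativeRankZeroAtTwoOfChildren : Prop :=
  MultPublishedInputsAtTwo → MultUpperHalfAtTwo → MultLowerHalfAtTwo → MultiplicativeRankZeroAtTwo

-- `MultiplicativeRankZeroAtTwoOfChildren` holds: proved by `Summit.BirchSwinnertonDyer.BirchSwinnertonDyer.Theorems.multiplicativeRankZeroAtTwoOfChildren_holds` (its module imports this route file, so no `_holds` link can be stated here).

/-- item stmt-BirchSwinnertonDyer-19265 · support · rank 9 · closed · proved by Summit.BirchSwinnertonDyer.BirchSwinnertonDyer.Theorems.twoAdicConverse_greenbergRankZeroFormulaAnyPrime_proof (prover) · by planner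
sources: GreenbergLNM1716
[support] Greenberg 1999 Thm 4.1 (rank-0 Euler-characteristic formula), parity-free statement at ANY
prime incl. p = 2, BY NAME — conjunct of OrdPublishedInputsAtTwo (19149;
Literature.Uncategorized.OrdPublishedInputsAtTwo l.31); same content, filed so the head constant is
item-stated (#15c one rule; cite_only dep); audited weaker-than-print at 2
(D-AUDIT-hEC-Gr99-Thm41-at-2, sha16 a27c8ad325fe9684) -/
@[route_item "route-BirchSwinnertonDyer-ByReductionTypeAtTwo"]
def GreenbergRankZeroFormulaAnyPrime : Prop :=
  Literature.NumberTheory.EllipticCurves.Greenberg1999.thm41_charValue_rankZero_anyPrime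

-- `GreenbergRankZeroFormulaAnyPrime` holds: proved by `Summit.BirchSwinnertonDyer.BirchSwinnertonDyer.Theorems.twoAdicConverse_greenbergRankZeroFormulaAnyPrime_proof` (its module imports this route file, so no `_holds` link can be stated here).

/-- item stmt-BirchSwinnertonDyer-19266 · support · rank 9 · open · by planner
sources: BCDT2001, BreuilConradDiamondTaylor2001
[support] modularity of E/ℚ as parametrisation data (Breuil–Conrad–Diamond–Taylor 2001 Thm A), BY
NAME — conjunct of OrdPublishedInputsAtTwo (19149; Literature.Uncategorized.OrdPublishedInputsAtTwo
l.26); same content, filed so the head constant is item-stated (#15c one rule; cite_only dep) -/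
@[route_item "route-BirchSwinnertonDyer-ByReductionTypeAtTwo", crux]
def ModularParametrizationSupply : Prop :=
  Literature.NumberTheory.EllipticCurves.ModularForms.nonempty_modularParametrizationData

/-- item stmt-BirchSwinnertonDyer-19273 · aside · rank 9 · open · by planner
sources: BCDTJAMS2001, Literature.NumberTheory.EllipticCurves.AnalyticRank
[support] entire continuation of L(E/ℚ, s) (modularity: Breuil–Conrad–Diamond–Taylor 2001 Thm A +
Hecke/Shimura), BY NAME — conjunct of MultConversePublishedInputsAtTwo (19185); same content, filed
so the head constant is item-stated (#15c one rule; cite_only dep) -/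
@[route_item "route-BirchSwinnertonDyer-ByReductionTypeAtTwo"]
def EntireLFunctionRat : Prop :=
  WeierstrassCurve.hasEntireLFunction_rat

/-- item stmt-BirchSwinnertonDyer-19307 · aside · rank 9 · open · by operator
sources: Cassels1965, MilneADT I.7.3, Literature.NumberTheory.EllipticCurves.BSDQuadraticDescent
[support] Cassels 1965 (Arithmetic on curves of genus 1, VIII; J. reine angew. Math. 217) / Milne
ADT Thm I.7.3 and Rem I.7.4: the BSD quotient (right-hand side of the BSD formula) is invariant
under isogeny over ℚ — conjunct of the support PrintedFacts (stmt-BirchSwinnertonDyer-19362), BY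
NAME; same content, filed as a split child so the head constant is item-stated (gate5 #15c one rule;
readiness rule 2026-08-15: cite_only dep declared by the route; director-bsd 2026-08-26T04:22Z
«K3/E2 shape»); no crux statement / closes / tribunal change -/
@[route_item "route-BirchSwinnertonDyer-ByReductionTypeAtTwo"]
def BSDQuotientIsogenyInvariance : Prop :=
  WeierstrassCurve.bsdRHS_eq_of_isIsogenous

/-- item stmt-BirchSwinnertonDyer-19372 · aside · rank 9 · open · by planner
sources: HoffsteinLuo1997
[aside] Hoffstein–Luo 1997 Theorem (§1, pp. 435–436), as used in Matsuno 2009 proof of Prop. 6.1: a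
quadratic twist with L(E^D,1) ≠ 0 under prescribed local conditions — conjunct of
PublishedInputsFive (stmt-BirchSwinnertonDyer-19066) kept inside the k = 7 rest child
ClassicalAndTwistInputsFive and item-stated here BY NAME as an ASIDE (banked context, never staffed,
BC6-exempt) so the cite_only dep is declared (#15c); no crux statement / closes / tribunal change -/
@[route_item "route-BirchSwinnertonDyer-ByReductionTypeAtTwo"]
def AsideHoffsteinLuoTwist : Prop :=
  Literature.NumberTheory.EllipticCurves.HoffsteinLuo1997_exists_twist_L_one_ne_zero

/-- item stmt-BirchSwinnertonDyer-19382 · aside · rank 9 · open · by planner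
sources: BCDT2001Modularity, Wiles1995FLT
[support] Modularity Theorem, Version L (Diamond–Shurman 2005 Thm. 8.8.3; Wiles / Taylor–Wiles /
BCDT 2001 Thm. A): every E/ℚ has a weight-2 newform f of level N_E with L(f,s) = L(E,s) — conjunct
of PublishedInputsFive (stmt-BirchSwinnertonDyer-19066), BY NAME; same content, filed as a split
child so the head constant is item-stated (gate5 #15c one rule / readiness rule 2026-08-15: a
cite_only dep must be declared by the route); no crux statement / closes / tribunal / tribunal_fit
change -/
@[route_item "route-BirchSwinnertonDyer-ByReductionTypeAtTwo"]
def AsideModularityNewform : Prop :=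
  Literature.NumberTheory.EllipticCurves.ModularForms.exists_isNewformOf

/-- item stmt-BirchSwinnertonDyer-19420 · aside · rank 9 · closed · proved by Summit.BirchSwinnertonDyer.BirchSwinnertonDyer.Theorems.casselsTatePairingRat_proof (prover) · by planner
sources: Cassels1962ArithmeticIV, Tate1963DualityICM
[support, cite-level BY-NAME ALIAS of a published input — never a prover target; held] Cassels,
Arithmetic on curves of genus 1 IV (Crelle 211, 1962) / Milne ADT I Thm. 6.13: existence of the
alternating Cassels–Tate pairing on Ш(E/ℚ) with divisible kernel (so #Ш[p^∞] is a square when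
finite). Conjunct 5 of `PublishedInputsO6` (the parity step of the rank-0 defect rows). -/
@[route_item "route-BirchSwinnertonDyer-ByReductionTypeAtTwo"]
def AsideCasselsTatePairing : Prop :=
  WeierstrassCurve.exists_casselsTate_pairing (K := ℚ)

/-- `AsideCasselsTatePairing` holds: proved by `Summit.BirchSwinnertonDyer.BirchSwinnertonDyer.Theorems.casselsTatePairingRat_proof`. -/
theorem AsideCasselsTatePairing_holds : AsideCasselsTatePairing := _root_.Summit.BirchSwinnertonDyer.BirchSwinnertonDyer.Theorems.casselsTatePairingRat_proof

/-- item stmt-BirchSwinnertonDyer-20090 · aside · rank 9 · closed · proved by Summit.BirchSwinnertonDyer.BirchSwinnertonDyer.Theorems.ManinLocalTwoThree.AbbesUllmoManinConstantGoodPrimes_proof (prover) · by planner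
sources: AbbesUllmo1996, Thm A
[support] BY NAME, cite_only input: Abbes–Ullmo 1996 Thm A — for the lattice-optimal datum and p ∤
N, p ∤ c (`abbesUllmo_not_dvd_maninConstant_of_not_dvd_level`); consumed by
`not_dvd_maninConstant_of_kodairaSymbolAt_eq_Istar`. [difficulty: hypothesis-only] -/
@[route_item "route-BirchSwinnertonDyer-ByReductionTypeAtTwo"]
def AsideAbbesUllmoManinAtTwo : Prop :=
  Literature.NumberTheory.EllipticCurves.ModularForms.abbesUllmo_not_dvd_maninConstant_of_not_dvd_level

/-- `AsideAbbesUllmoManinAtTwo` holds: proved by `Summit.BirchSwinnertonDyer.BirchSwinnertonDyer.Theorems.ManinLocalTwoThree.AbbesUllmoManinConstantGoodPrimes_proof`. -/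
theorem AsideAbbesUllmoManinAtTwo_holds : AsideAbbesUllmoManinAtTwo := _root_.Summit.BirchSwinnertonDyer.BirchSwinnertonDyer.Theorems.ManinLocalTwoThree.AbbesUllmoManinConstantGoodPrimes_proof

/-- item stmt-BirchSwinnertonDyer-22584 · aside · rank 9 · open · by operator
sources: Lim2017
[aside · cite-only head BY NAME] Lim 2017 Thm 3.5 at p = 2: fine Selmer dual finitely generated over
ℤ₂ from classical μ = 0 of a carrier field L with ℚ(E[2]) ≤ L ≤ ℚ(E[4]) of 2-power index (scope
rider honoured). -/
@[route_item "route-BirchSwinnertonDyer-ByReductionTypeAtTwo"]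
def AsideLim2017AtTwo : Prop :=
  Literature.NumberTheory.EllipticCurves.Lim2017.thm35_at_two_fineSelmerDual_moduleFinite_of_classicalMuVanishes_of_le_divisionField_four

/-- item stmt-BirchSwinnertonDyer-22585 · aside · rank 9 · open · by operator
sources: FerreroWashington1979
[aside · cite-only head BY NAME] Ferrero–Washington 1979: the classical Iwasawa μ-invariant of the
cyclotomic ℤ_p-extension of an abelian number field vanishes (used at p = 2 on ℚ(E[2], i)). -/
@[route_item "route-BirchSwinnertonDyer-ByReductionTypeAtTwo"]
def AsideFerreroWashington : Prop :=
  Literature.NumberTheory.IwasawaTheory.ferreroWashington1979_classicalMuVanishes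

/-- item stmt-BirchSwinnertonDyer-22586 · aside · rank 9 · open · by operator
sources: Kato2004Asterisque
[aside · cite-only head BY NAME] the Kato 2004 Thm 12.5 (1)(3) SHARP reading at p = 2 (rank 0, ρ̄
irreducible, fine Selmer dual f.g. ⇒ ord₂(#Ш) + ord₂(Tam) ≤ L-side), typed by addL2x GEN 8 p607304,
audit-2 GEN 34 D-audit PASS. -/
@[route_item "route-BirchSwinnertonDyer-ByReductionTypeAtTwo"]
def AsideKatoSharpAtTwo : Prop :=
  Literature.NumberTheory.EllipticCurves.Kato2004.rankZero_padicValNat_sha_add_padicValNat_tamagawa_le_at_two_of_irreducible_of_fineSelmerDual_fg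

/-- item stmt-BirchSwinnertonDyer-22587 · aside · rank 9 · open · by operator
sources: Kato2004Asterisque
[aside · by-name published input, never staffed] Kato 2004 Thm 12.4/12.5(1)–(3)/12.6 + 13.10(1) +
13.14/§14.14/14.5/14.16(2) AT KATO'S MEMBER for reducible E[2], additive potentially good 2 — the p
= 2 twin of bsd-potss-rkm's referee-verified member package (addL2x GEN 10 p624448; statement-only
READING, D-audited PASS: audit-2 GEN 40 sheet
D-AUDIT-hMH2-Kato04-Thm124-126-L1310-1414-memberHull-reducible-at-2.md @45f032fcb4a07b00, evidence
#51 on 19098). -/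
@[route_item "route-BirchSwinnertonDyer-ByReductionTypeAtTwo"]
def AsideKatoMemberHullTwo : Prop :=
  Literature.NumberTheory.EllipticCurves.Kato2004.exists_memberHullInputs_two

/-- item stmt-BirchSwinnertonDyer-23771 · aside · rank 9 · closed · proved by Summit.BirchSwinnertonDyer.BirchSwinnertonDyer.Theorems.ByReductionTypeAtTwo.AsideStevensOptimalGamma1AtTwo_proof (prover) · by operator
sources: Stevens1989, §2, ConradEdixhovenStein2003, §6.1
[aside · cite-only head of the print bundle OrdMLBPrintBundleAtTwo (stmt-23764) declared BY NAME —
never staffed] Stevens 1989 §2 / Conrad–Edixhoven–Stein 2003 §6.1: existence of the optimal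
Γ₁(N)-parametrisation datum (T2 of line kato_free_lower_sandwich_two). -/
@[route_item "route-BirchSwinnertonDyer-ByReductionTypeAtTwo"]
def AsideStevensOptimalGamma1AtTwo : Prop :=
  Literature.NumberTheory.EllipticCurves.ModularForms.exists_optimal_gamma1ParametrizationData

-- `AsideStevensOptimalGamma1AtTwo` holds: proved by `Summit.BirchSwinnertonDyer.BirchSwinnertonDyer.Theorems.ByReductionTypeAtTwo.AsideStevensOptimalGamma1AtTwo_proof` (its module imports this route file, so no `_holds` link can be stated here).

/-- item stmt-BirchSwinnertonDyer-23781 · aside · rank 9 · closed · proved by Summit.BirchSwinnertonDyer.BirchSwinnertonDyer.Theorems.asideKatoMuPartAtTwoOfTowerGap_proof (prover) · by operator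
sources: Washington1997, §13.2, Kato2004Asterisque, Thm 17.4, Summits/BirchSwinnertonDyer/Rank1Residual/X5/KatoOrdTwoMuPart.lean (katoMuPartAtTwo_of_towerGapAtTwo)
[aside · DECLARES the conjecture leaf `X5.O1.KatoMuPartAtTwo` (head constant; rev-11 idiom of
19271/19272) — the text is the X5 KERNEL THEOREM `katoMuPartAtTwo_of_towerGapAtTwo` (tower-gap
certificate μ₂ = 0 ⇒ Kato μ-part at 2), so it closes at once by name and is never staffed; it adds
NO conjecture content. Reached because child B7 `OrdKatoMuPartOptimalAtTwo` (stmt-23761) asserts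
`KatoMuPartAtTwo W′` at the Kato-optimal member.] Closer: `theorem … :
…ByReductionTypeAtTwo.AsideKatoMuPartAtTwoOfTowerGap := fun W _ _ h =>
Summit.BirchSwinnertonDyer.Rank1Residual.X5.O1.katoMuPartAtTwo_of_towerGapAtTwo W h`. -/
@[route_item "route-BirchSwinnertonDyer-ByReductionTypeAtTwo"]
def AsideKatoMuPartAtTwoOfTowerGap : Prop :=
  ∀ (W : WeierstrassCurve ℚ) [W.IsElliptic] [W.IsGloballyMinimal], Summit.BirchSwinnertonDyer.Rank1Residual.X5.O1.TowerGapAtTwo W → Summit.BirchSwinnertonDyer.Rank1Residual.X5.O1.KatoMuPartAtTwo W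

-- `AsideKatoMuPartAtTwoOfTowerGap` holds: proved by `Summit.BirchSwinnertonDyer.BirchSwinnertonDyer.Theorems.asideKatoMuPartAtTwoOfTowerGap_proof` (its module imports this route file, so no `_holds` link can be stated here).

/-- item stmt-BirchSwinnertonDyer-23878 · aside · rank 9 · closed · proved by Summit.BirchSwinnertonDyer.BirchSwinnertonDyer.Theorems.Prop514AtTwo.prop514_isTorsion_mu_eq_zero_two_holds (prover) · by operator
sources: GreenbergLNM1716, Prop. 5.14 (p. 121; chunk p0170), §5 defs (p0168), Literature/NumberTheory/EllipticCurves/Greenberg1999/TwoTorsionMuInvariant.lean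
[aside · cite-only head BY NAME] Greenberg, LNM 1716 (1999), Prop. 5.14 at p = 2: E/ℚ good ordinary
or multiplicative at 2 with a rational 2-torsion point P such that ⟨P⟩ is ramified-at-2 XOR odd ⇒
Sel(E/ℚ_∞)₂ is Λ-cotorsion and μ_E = 0 (`Greenberg1999.prop514_isTorsion_mu_eq_zero_two`, D-audit
h514 PASS). Third conjunct of the re-cut print bundle 23759; consumed by
`SteinbergFibreAtTwo.katoMuPartAtOptimalMember_of_prop514_of_off514` /
`ordKatoHalfAtTwoIso_of_recut_cite` (p679274). Never staffed. -/
@[route_item "route-BirchSwinnertonDyer-ByReductionTypeAtTwo"]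
def AsideGreenbergProp514AtTwo : Prop :=
  Literature.NumberTheory.EllipticCurves.Greenberg1999.prop514_isTorsion_mu_eq_zero_two

/-- `AsideGreenbergProp514AtTwo` holds: proved by `Summit.BirchSwinnertonDyer.BirchSwinnertonDyer.Theorems.Prop514AtTwo.prop514_isTorsion_mu_eq_zero_two_holds`. -/
theorem AsideGreenbergProp514AtTwo_holds : AsideGreenbergProp514AtTwo := _root_.Summit.BirchSwinnertonDyer.BirchSwinnertonDyer.Theorems.Prop514AtTwo.prop514_isTorsion_mu_eq_zero_two_holds

/-- item stmt-BirchSwinnertonDyer-23905 · support · rank 9 · open · by operator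
sources: Kato2004Asterisque, Thm. 12.4–12.6, (12.5.1), Lemma 13.10, 13.13, Thm. 14.5, §14.8, Prop. 14.16 (2), GreenbergLNM1716, Prop. 4.13, MazurRubin2004, Thm. 2.3.4, Lim2017FineSelmer, Thm. 3.5
[support · print head BY NAME — never staffed] Kato 2004 member package at p = 2 for E[2]-REDUCIBLE
additive curves with no split multiplicative twist by −1/−2 (NST′), with the SHARP structure count
#H¹_F(ℚ,T)·#(S₂(E/ℚ)/H¹_F(ℚ,T)) = 2^t (R12♯ = five-term Poitou–Tate for the pair F₀* ≤ F*, Greenberg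
LNM 1716 Prop. 4.13 / MR 2.3.4); p673967; audit-2 GEN 56 D-AUDIT hMH2♯ PASS @69967b4916f4bfe0
(AS-PRINTED/EXACT; reading flags AUDITED-SOUND). Implies the potentially-good sharp head
`exists_memberHullInputs_two_sharp` (p673332) by p674406 §0. Consumed by
`AdditivePotGoodReducibleRestAtTwoOfInputs` (C2″) and by p674406
`addPotMultNST_reducibleUpper_two_sharp` (the NST′ reducible part of C4″'s upper half). -/
@[route_item "route-BirchSwinnertonDyer-ByReductionTypeAtTwo", crux]
def AddRedSharpCountReadingAtTwo : Prop :=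
  Literature.NumberTheory.EllipticCurves.Kato2004.exists_memberHullInputs_two_sharp_of_noSplitTwistNegOneNegTwo

/-- item stmt-BirchSwinnertonDyer-23906 · support · rank 9 · closed · proved by Summit.BirchSwinnertonDyer.BirchSwinnertonDyer.Theorems.additivePotGoodReducibleRestAtTwoOfInputs_proof (prover) · by operator
sources: Kato2004Asterisque, Prop. 14.16 (2), Cassels1965ArithmeticVIII, Summits/BirchSwinnertonDyer/BirchSwinnertonDyer/Theorems/ByReductionTypeAtTwoAdditiveReducibleKatoMemberSharp.lean (p673737)
[support · glue, closes AT ONCE] C2″ `AdditivePotGoodReducibleRestAtTwo` (stmt-22616) from the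
published inputs 22619 and the sharp print head BY NAME: `fun hPub hinS => by obtain ⟨hGZK, hrat, _,
_, hLim2, hFW, _, hmodN, _, hCassels, _⟩ := hPub; exact
AddKatoTwo.additivePotGoodReducibleRestAtTwo_of_sharpMember hmodN hrat
(AddKatoTwo.exists_memberHullInputs_two_sharp_of_noSplitTwistSharp hinS) hLim2 hFW hCassels hGZK`
(p673737 + p674406 §0; certificate CertAddRedTurnkeyV1.lean rc 0). Any K4-ACL prover files it
`--workitem <this item>` importing Theorems.ByReductionTypeAtTwoAdditiveReducibleKatoMemberSharpNST. -/
@[route_item "route-BirchSwinnertonDyer-ByReductionTypeAtTwo"]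
def AdditivePotGoodReducibleRestAtTwoOfInputs : Prop :=
  AdditivePrintedInputsAtTwo → AddRedSharpCountReadingAtTwo → AdditivePotGoodReducibleRestAtTwo

-- `AdditivePotGoodReducibleRestAtTwoOfInputs` holds: proved by `Summit.BirchSwinnertonDyer.BirchSwinnertonDyer.Theorems.additivePotGoodReducibleRestAtTwoOfInputs_proof` (its module imports this route file, so no `_holds` link can be stated here).

/-- item stmt-BirchSwinnertonDyer-24149 · aside · rank 9 · open · by planner
sources: Milne1972ArithmeticAV
[support] Milne 1972 Thm 1 (BSD quotient under quadratic base change, any model; named Literature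
fact, cite-level; head constant). Source: Milne1972. -/
@[route_item "route-BirchSwinnertonDyer-ByReductionTypeAtTwo"]
def AsideMilne1972WeilRestriction : Prop :=
  Literature.NumberTheory.EllipticCurves.Milne1972.bsdQuotient_baseChange_quadratic_anyModel

/-- item stmt-BirchSwinnertonDyer-32821 · support · rank 9 · open · by planner
[support · declared LINE-RESIDUAL of 23715 (two-transposition door T-2q / AN-26)] S_id of
Cruxes/RankOneAtTwoBigImageOddLocal/Lines/egg_kolyvagin_two.lean v6 l.372 VERBATIM (line-local
`OnIdLocus W` l.77 replaced by its byte-identical body, names qualified): non-CM, surjective mod 2^n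
for all n, r_an = 1, Δ > 0, E(ℚ)[2] = 0, Ш[2] = 0, E(ℚ) ⊂ E⁰(ℝ) (¬MeetsEgg), ∏c_ℓ odd ⇒ BSD₂.
Consumed BY NAME by the egg line (S_id) and by GK2 LINE 23 S4″b (MinimalTwinBSDTwo; #Sel₂ = 2 via
Literature natCard_selmerGroup_eq); small-image remainder is inside 23716. Why it might fail: it is
the identity-locus residual of the two-transposition door — no Euler-system / visibility input at 2
is known on Δ > 0, E(ℚ)[2] = 0 beyond Kolyvagin's odd-p range; director-bsd (548)(A)(i). [cite:
Kramer1981, Prop. 3] [cite: MazurRubin2010, Lemma 3.5] [deps: none] [difficulty: XL] -/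
@[route_item "route-BirchSwinnertonDyer-ByReductionTypeAtTwo"]
def RankOneAtTwoBigImageIdLocus : Prop :=
  ∀ (W : WeierstrassCurve ℚ) [W.IsElliptic] [W.IsGloballyMinimal], ¬ W.HasCM → (∀ n : ℕ, W.HasSurjectiveModNGaloisRep ((2 ^ n : ℕ) : ℤ)) → W.analyticRank = 1 → (0 < W.Δ ∧ Summit.BirchSwinnertonDyer.Rank1Residual.F1Sign2.NoRationalTwoTorsion W ∧ Summit.BirchSwinnertonDyer.Rank1Residual.F1Sign2.ShaTwoTrivial W ∧ ¬ Summit.BirchSwinnertonDyer.Rank1Residual.F1Sign2.MeetsEgg W ∧ ¬ 2 ∣ W.tamagawaProduct) → Literature.NumberTheory.EllipticCurves.BSDp W 2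

/-- item stmt-BirchSwinnertonDyer-19567 · support · rank 204 · open · by planner
why it might fail: n/a (published)
sources: Cassels1965ArithmeticVIII, MilneADT2006 Thm I.7.3, BreuilConradDiamondTaylor2001
[support · PUB rider, rank 204] Cassels 1965 isogeny invariance of the BSD quotient (Milne ADT
I.7.3) ∧ entire L-function of E/ℚ (modularity). Rider needed to move BSD₂ back along the isogeny in
the (β) glue. Never to be proved in the route: cite-level. -/
@[route_item "route-BirchSwinnertonDyer-ByReductionTypeAtTwo", crux]
def OrdIsoPublishedInputsAtTwo : Prop :=
  WeierstrassCurve.bsdRHS_eq_of_isIsogenous ∧ WeierstrassCurve.hasEntireLFunction_rat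

/-- item stmt-BirchSwinnertonDyer-19578 · support (kind.auto-crux: conjecture-grade) · rank 207 · closed · proved by Summit.BirchSwinnertonDyer.BirchSwinnertonDyer.Theorems.goodOrdinaryRankZeroAtTwoOfChildrenIsoMLB_proof (prover) · by planner
why it might fail: auto-crux — conjecture-grade statement (statement references the registered conjecture Summit.BirchSwinnertonDyer.BirchSwinnertonDyer.Theorems.OrdHalvesAtTwo.OrdMissingLowerBoundAtTwo); it is open, so it may simply be false
sources: Cassels1965 (isogeny invariance of BSD), GreenbergLNM1716 Thm 4.1, pub/bsd-2adic/plan/routes/resplit-19095-K6/Sketch-K6.lean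
[support · glue, rank 207; the three NEW children are written OUT (their item statements verbatim,
definitionally equal to OrdIsoPublishedInputsAtTwo / OrdKatoHalfAtTwoIso /
OrdMissingLowerBoundAtTwo) so the decl elaborates wherever the gate renders it] PUBLISHED inputs
(19149) + Cassels/entire-L rider + the Kato half UP TO ISOGENY + the descent inequality ⇒
`GoodOrdinaryRankZeroAtTwo` (19095). PROVED in the planner sketch
pub/bsd-2adic/plan/routes/resplit-19095-K6/Sketch-K6.lean
(`goodOrdinaryRankZeroAtTwo_of_children_iso_missingLowerBound`, farm rc 0, 0 sorry: choose the
isogenous member W′ carrying the Kato half, transport non-CM / analytic rank 0 / good-ordinary / the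
descent inequality along the isogeny (X12.hasCM_iff_of_isIsogenous, analyticRank_eq_of_isIsogenous′,
missingLowerBoundAt_of_isIsogenous), close BSD₂(W′) by missingPPartAt_of_lower_of_upper +
bsdp_of_missingPPartAt, pull back by Cassels X2.bsdp_of_isIsogenous_of_bsdp) — a prover lands it as
Theorems/ByReductionTypeAtTwoGoodOrdinaryRankZeroOfChildrenIsoMLB.lean. Replaces the closed glue
19152 (which consumed 19271 + 19272) in `closes`. -/
@[route_item "route-BirchSwinnertonDyer-ByReductionTypeAtTwo", crux]
def GoodOrdinaryRankZeroAtTwoOfChildrenIsoMLB : Prop :=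
  OrdPublishedInputsAtTwo → (WeierstrassCurve.bsdRHS_eq_of_isIsogenous ∧ WeierstrassCurve.hasEntireLFunction_rat) → (∀ (W : WeierstrassCurve ℚ) [W.IsElliptic] [W.IsGloballyMinimal], ¬ W.HasCM → W.analyticRank = 0 → Literature.NumberTheory.EllipticCurves.Rank1Residual.GoodOrd W 2 → ∃ (W' : WeierstrassCurve ℚ) (_ : W'.IsElliptic) (_ : W'.IsGloballyMinimal), WeierstrassCurve.IsIsogenous W W' ∧ Summit.BirchSwinnertonDyer.Rank1Residual.X5.O1.MainConjectureLowerDivisibilityAtTwoOrd W') → Summit.BirchSwinnertonDyer.BirchSwinnertonDyer.Theorems.OrdHalvesAtTwo.OrdMissingLowerBoundAtTwo → GoodOrdinaryRankZeroAtTwo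

-- `GoodOrdinaryRankZeroAtTwoOfChildrenIsoMLB` holds: proved by `Summit.BirchSwinnertonDyer.BirchSwinnertonDyer.Theorems.goodOrdinaryRankZeroAtTwoOfChildrenIsoMLB_proof` (its module imports this route file, so no `_holds` link can be stated here).

/-- item stmt-BirchSwinnertonDyer-19100 · assembly · rank 1 · closed · proved by Summit.BirchSwinnertonDyer.BirchSwinnertonDyer.Theorems.byReductionTypeAtTwo_assembly_proof @ 325b10ddc517 (prover) · by planner
sources: Miller2011, LMFDB
[assembly] GoodOrdinaryRankZeroAtTwo → MultiplicativeRankZeroAtTwo → SupersingularRankZeroAtTwo →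
AdditiveRankZeroAtTwo → RankOneAtTwo → the rung leaf NonCMAtTwo (by cases on the analytic rank and
on the reduction type at 2). -/
@[route_item "route-BirchSwinnertonDyer-ByReductionTypeAtTwo", crux]
def Assembly : Prop :=
  GoodOrdinaryRankZeroAtTwo → MultiplicativeRankZeroAtTwo → SupersingularRankZeroAtTwo → AdditiveRankZeroAtTwo → RankOneAtTwo → Summit.BirchSwinnertonDyer.BirchSwinnertonDyer.Rank1Residual.NonCMAtTwo

-- `Assembly` holds: proved by `Summit.BirchSwinnertonDyer.BirchSwinnertonDyer.Theorems.byReductionTypeAtTwo_assembly_proof` @ 325b10ddc517 (its module imports this route file, so no `_holds` link can be stated here).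

/-! D-0027 §2.1 — DECIDING THEOREM (planner-authored via `route open/edit --closes-file`; by planner-bsd-2adic-plan-g13-0 2026-08-26T08:50:02Z):
its hypotheses are this route's items and its conclusion the registered leaf `Summit.BirchSwinnertonDyer.BirchSwinnertonDyer.Rank1Residual.NonCMAtTwo` (rung K4, D-0061) (glue_lint), and it elaborates with this file. -/

-- closes for K4 after riders K-1 (β) + K-6 COMBINED: re-split of GoodOrdinaryRankZeroAtTwo (19095) into
-- OrdPublishedInputsAtTwo (19149) · OrdIsoPublishedInputsAtTwo (NEW support, PUB; children-beta.json) · OrdKatoHalfAtTwoIso (NEW crux r202; children-beta.json) · OrdMissingLowerBoundAtTwo (NEW crux r203; children-K6.json)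
-- with glue decl GoodOrdinaryRankZeroAtTwoOfChildrenIsoMLB : OrdPublishedInputsAtTwo → OrdIsoPublishedInputsAtTwo → OrdKatoHalfAtTwoIso → OrdMissingLowerBoundAtTwo → GoodOrdinaryRankZeroAtTwo
-- (proof term = Sketch-K6.lean `goodOrdinaryRankZeroAtTwo_of_children_iso_missingLowerBound`, farm rc 0, 0 sorry).
-- 19271 stays in the file as the (α) item implying OrdKatoHalfAtTwoIso (`ordKatoHalfAtTwoIso_of_ordKatoHalfAtTwo`); 19272 leaves K4's cone.
@[closes "route-BirchSwinnertonDyer-ByReductionTypeAtTwo"] theorem closes (hOrdPub : OrdPublishedInputsAtTwo) (hOrdPubI : OrdIsoPublishedInputsAtTwo) (hOrdKI : OrdKatoHalfAtTwoIso)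
    (hOrdL : OrdMissingLowerBoundAtTwo) (hOrdGI : GoodOrdinaryRankZeroAtTwoOfChildrenIsoMLB)
    (hMultPub : MultPublishedInputsAtTwo) (hMultU : MultUpperHalfAtTwo) (hMultL : MultLowerHalfAtTwo)
    (hMultG : MultiplicativeRankZeroAtTwoOfChildren) (hSS : SupersingularRankZeroAtTwo) (hAdd : AdditiveRankZeroAtTwo)
    (hR1 : RankOneAtTwo) (hA : Assembly) :
    Summit.BirchSwinnertonDyer.BirchSwinnertonDyer.Rank1Residual.NonCMAtTwo :=
  hA (hOrdGI hOrdPub hOrdPubI hOrdKI hOrdL) (hMultG hMultPub hMultU hMultL) hSS hAdd hR1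

end Summit.BirchSwinnertonDyer.BirchSwinnertonDyer.Theses.ByReductionTypeAtTwo
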